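import Literature.NumberTheory.GaloisRepresentations.SerreWeight
import Literature.NumberTheory.GaloisRepresentations.TameInertia
import Literature.NumberTheory.GaloisRepresentations.LocalGaloisGroupFrobeniusProofs
import Literature.NumberTheory.GaloisRepresentations.AbsGaloisGroupCompact
import Mathlib.LinearAlgebra.Matrix.CharP
import HarnessLib

/-!
# Towards `2 ≤ k(ρ̄_F)`: Serre's Prop. 1 and the existence of a Serre weight (trunk GalRep, item C16)

D-0014 keeps `Literature/` sorry-free by stating cited results as named facts `def X : Prop`.
This second sibling file of `Literature.NumberTheory.GaloisRepresentations.SerreWeight`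
(after `SerreWeightProofs`) works towards the named facts
`Literature.NumberTheory.GaloisRepresentations.ModPGaloisRep.exists_isSerreWeight` (Serre's Prop. 1: some case of the recipe applies) and
`Literature.NumberTheory.GaloisRepresentations.ModPGaloisRep.two_le_serreWeightLocal` (`2 ≤ k(ρ̄_F)` for `k` discrete), and proves both
*from three named structure facts on the inertia group of `F`* (file `TameInertia`:
`absUpperInertia_map_isPGroup`, `absInertia_map_isCyclic`, `exists_eq_kummerCharacter_pow`):
`exists_isSerreWeight_of_facts`, `two_le_serreWeightLocal_of_facts`.

## What the source says

Serre, Duke Math. J. 54 (1987), §2.6 ("Valeurs de `k`") records that for `p ≠ 2` the possible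
values of `k` are the integers of `[2, p² - 1]` of the form `1 + a₀ + p a₁`
(`0 ≤ a₀, a₁ ≤ p - 1`, `a₁ ≤ a₀ + 1`), and that for `p = 2` one has `k = 2` or `k = 4`;
§2.2 Remarque (1) and §2.3 Remarque (1) note that the smallest value is `k = 2`.  Here `k` is
the weight attached in §§2.2–2.4 to a `ρ_p : G_p → GL₂(𝔽̄_p)` whose restriction to inertia has
one of the shapes of §2.1, Prop. 1: *the characters `φ, φ'` giving the action of the tame
inertia `I_t` on `V^ss` are of level 1 or 2, and if of level 2 they are conjugate
(`φ' = φ^p`, `φ = φ'^p`)*; Serre's proof: `I_p` acts trivially on `V^ss` ([41] = Serre 1972,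
Prop. 4), the action of `I_t` is diagonalisable, conjugation by a Frobenius `s` acts on
`I_t = I/I_p` by `u ↦ u^p`, so `{φ, φ'}` is stable under `φ ↦ φ^p`, whence (a) `φ^p = φ`,
`φ'^p = φ'` or (b) `φ^p = φ'`, `φ'^p = φ`, `φ ≠ φ'`.  In the wild case (§2.4) the fixed
vectors of `I_p` form a line `D` stable under `G_p` and `ρ_p = (θ₂ *; 0 θ₁)`.

## Proof architecture

* §TwoLe (arithmetic of the recipe).  Each case of the recipe only produces values `≥ 2`:
  level two (2.2.4) `k = 1 + pa + b` with `a < b`; level one tame (2.3.2); level one wild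
  (2.4.5), (2.4.8), (2.4.9) with `1 ≤ β` — `two_le_of_isSerreWeight`.  Hence the lower bound
  follows from the named fact `exists_isSerreWeight` (`two_le_serreWeightLocal_of_exists`);
  conversely the junk value `sInf ∅ = 0` of `serreWeightLocal` makes the two facts *equivalent*
  (`two_le_serreWeightLocal_iff_exists_isSerreWeight`), so Prop. 1 is exactly what is needed.
* Namespace `InertiaShape` (Serre's Prop. 1 in matrix form, for an arbitrary non-archimedean
  local field `F`, `q = #𝓀[F]`, and any field `k` with the discrete topology receiving a
  residue embedding `ι : S ⧸ 𝔓 →+* k`).  Inputs: the named facts of `TameInertia`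
  (`absUpperInertia_map_isPGroup`: `ρ̄(I_F^v)` is a `p`-group for `v > 0`;
  `absUpperInertia_normal`; `absInertia_map_isCyclic`: a tame `ρ̄(I_F)` is cyclic of order
  prime to `p`; `exists_eq_kummerCharacter_pow`: continuous characters of `I_F` of exponent
  `d`, `p ∤ d`, are powers of `θ_d`); and the theorems `exists_isFrobPow_holds` (a Frobenius
  exists, file `LocalGaloisGroupFrobeniusProofs`), `absUpperInertia_normal`, `kummerCharacter_conj_apply`
  (`θ_d(τστ⁻¹) = θ_d(σ)^q`), `absInertia_normal_holds`, `absoluteGaloisGroup_compactSpace`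
  (finite image, `finite_range_local`).
  - *Wild case* (`exists_common_eigenvector_of_not_isTamelyRamified`): `W = ρ̄(I_F^{v₀}) ≠ 1`
    is a normal `p`-subgroup of the finite group `ρ̄(Γ_F)`; a central `z ≠ 1` of `W` is
    unipotent, its fixed line `k v` is fixed by `W` (characters of `p`-power order of `W` are
    trivial) and is *the* fixed line of `W`, hence stable under `ρ̄(Γ_F)`: `ρ̄` is triangular
    on all of `Γ_F` (`exists_conj_triangular`), so its diagonal characters are invariant under
    Frobenius conjugation; comparing with `χ(τστ⁻¹) = χ(σ)^q` (`diagChar_conj_eq_pow`) gives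
    `χ^q = χ`, i.e. level one, and `exists_eq_kummerCharacter_pow` with `d = q - 1` writes
    `χ = ψ₁^b`: `exists_isLevelOneWildWeight` (normalisation (2.4.3)).
  - *Tame case* (`exists_conj_diagonal_of_isTamelyRamified`): `ρ̄(I_F) = ⟨g₀⟩` is cyclic of
    order `N` prime to `p` and `k ∋ ζ_N` (`exists_isPrimitiveRoot_of_not_dvd`), so `g₀` is
    diagonalisable over `k` (division of `X^N - 1` by the characteristic polynomial,
    Cayley–Hamilton, separability of `X^N - 1`).  The diagonal characters `χ₀, χ₁` satisfy
    `{χ₀(σ)^q, χ₁(σ)^q} = {χ₀(σ), χ₁(σ)}` (trace and determinant of the conjugate matrices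
    `ρ̄(τστ⁻¹) ∼ ρ̄(σ)`), and a group is not the union of two proper subgroups, so
    (`level_dichotomy`) either `χ_i^q = χ_i` (level one: `χ_i = ψ₁^{b_i}`, normalise modulo
    `q - 1`, order `a ≤ b` by the permutation matrix `swapGL`: `IsLevelOneTameWeight`) or
    `χ₀^q = χ₁`, `χ₁^q = χ₀`, `χ₀ ≠ χ₁` (level two: `χ₀^{q²-1} = 1`, `χ₀ = ψ₂^n`,
    `n ≡ a + qb`, `χ₁ = ψ₂^{qa+b}`, `a ≠ b`, order `a < b` by `swapGL`: `IsLevelTwoWeight`):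
    `exists_isLevelTwoWeight_or_isLevelOneTameWeight`.
  - `exists_isSerreWeight_of_facts` and `two_le_serreWeightLocal_of_facts` assemble the two
    cases.  An unconditional `two_le_serreWeightLocal_holds` needs exactly the discharge of
    the three named facts in their hypotheses (`absUpperInertia_map_isPGroup`: `G_1` is a
    `p`-group; `absInertia_map_isCyclic`: structure of tame inertia with Herbrand's theorem;
    `exists_eq_kummerCharacter_pow`: Kummer theory over `F^{nr}`).

## References

* J.-P. Serre, *Sur les représentations modulaires de degré 2 de `Gal(ℚ̄/ℚ)`*, Duke Math. J.
  54 (1987) (= Œuvres IV, no. 143), §2.1 Prop. 1 (and its proof); §2.2 (2.2.1)–(2.2.4),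
  Remarque (1); §2.3 (2.3.1)–(2.3.2), Remarque (1); §2.4 (2.4.1)–(2.4.5), (2.4.8)–(2.4.9);
  §2.6. [Serre1987]
* J.-P. Serre, *Propriétés galoisiennes des points d'ordre fini des courbes elliptiques*,
  Invent. Math. 15 (1972), §1.3 (Prop. 1–2), §1.6 (Prop. 4), §1.7 (Prop. 5).
  [SerreInventiones1972]
-/

noncomputable section

open scoped Valued Matrix
open Field ValuativeRel

namespace Literature.NumberTheory.GaloisRepresentations

namespace ModPGaloisRep

universe u v

open GaloisRepresentations.IsNonarchimedeanLocalField

section TwoLe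

open GaloisRepresentations.IsNonarchimedeanLocalField

variable {F : Type u} [Field F] [ValuativeRel F] [TopologicalSpace F] [IsNonarchimedeanLocalField F]
variable {k : Type v} [Field k] [TopologicalSpace k]
variable {ρ : ModPGaloisRep F k 2} {ι : absIntegers 𝒪[F] F ⧸ absMaximalIdeal F →+* k}

/-- A level-two weight is at least `2`: `m = 1 + q a + b` with `0 ≤ a < b`, so `b ≥ 1`.
Ref: Serre, Duke Math. J. 54 (1987), §2.2, (2.2.3)–(2.2.4) and Remarque (1) ("la plus petite
valeur possible de `k` est `k = 2`"). [cite: Serre1987, §2.2 (2.2.3)–(2.2.4) and Remarque (1)] -/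
theorem two_le_of_isLevelTwoWeight {m : ℕ} (h : ρ.IsLevelTwoWeight ι m) : 2 ≤ m := by
  obtain ⟨a, b, hab, -, -, rfl⟩ := h
  generalize residueFieldCard F * a = t
  omega

/-- A level-one tame weight is at least `2`: it is `q ≥ 2` if `(a, b) = (0, 0)` (note
`b + 2 ≤ q`), and `1 + q a + b` with `b ≥ 1` otherwise (`a ≤ b`, `(a, b) ≠ (0, 0)`).
Ref: Serre, Duke Math. J. 54 (1987), §2.3, (2.3.1)–(2.3.2) and Remarque (1).
[cite: Serre1987, §2.3 (2.3.1)–(2.3.2) and Remarque (1)] -/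
theorem two_le_of_isLevelOneTameWeight {m : ℕ} (h : ρ.IsLevelOneTameWeight ι m) : 2 ≤ m := by
  obtain ⟨-, a, b, hab, hb, -, rfl⟩ := h
  generalize residueFieldCard F = q at *
  split_ifs with h0
  · omega
  · have hb1 : 1 ≤ b := by
      rcases Nat.eq_zero_or_pos b with hb0 | hb0
      · exact absurd ⟨Nat.le_zero.mp (hb0 ▸ hab), hb0⟩ h0
      · exact hb0
    generalize q * a = t
    omega

/-- A level-one wild weight is at least `2`: with `1 ≤ β ≤ q - 1` the value is `4`, or
`(α + 1)(q + 1) ≥ 2`, or `1 + q min(α, β) + max(α, β) ≥ 1 + β ≥ 2`.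
Ref: Serre, Duke Math. J. 54 (1987), §2.4, (2.4.3)–(2.4.5), (2.4.8)–(2.4.9); §2.6.
[cite: Serre1987, §2.4 (2.4.3)–(2.4.5), (2.4.8)–(2.4.9); §2.6] -/
theorem two_le_of_isLevelOneWildWeight {m : ℕ} (h : ρ.IsLevelOneWildWeight ι m) : 2 ≤ m := by
  obtain ⟨-, α, β, hα, hβ, hβ', -, rfl⟩ := h
  generalize residueFieldCard F = q at *
  split_ifs with h1 h2
  · omega
  · calc 2 ≤ (0 + 1) * (1 + 1) := by norm_num
      _ ≤ (α + 1) * (q + 1) := Nat.mul_le_mul (by omega) (by omega)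
  · have hmax : β ≤ max α β := le_max_right α β
    generalize q * min α β = t at *
    omega

/-- **A Serre weight is at least `2`** (each case of the recipe gives a value `≥ 2`).
Ref: Serre, Duke Math. J. 54 (1987), §2.6 ("Valeurs de `k`": `k ∈ [2, p² - 1]` for `p ≠ 2`,
`k ∈ {2, 4}` for `p = 2`). [cite: Serre1987, §2.6 (Valeurs de k)] -/
theorem two_le_of_isSerreWeight {m : ℕ} (h : ρ.IsSerreWeight ι m) : 2 ≤ m :=
  h.elim (fun h => two_le_of_isLevelTwoWeight h) fun h =>
    h.elim (fun h => two_le_of_isLevelOneTameWeight h) fun h => two_le_of_isLevelOneWildWeight h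

variable (ρ ι)

/-- **Reduction of the lower bound to Serre's Prop. 1.**  `two_le_serreWeightLocal` follows
from the existence of an inertia shape (`exists_isSerreWeight`), via
`isSerreWeight_serreWeightLocal_of` and `two_le_of_isSerreWeight`.
Ref: Serre, Duke Math. J. 54 (1987), §2.1 Prop. 1; §2.6. [cite: Serre1987, §2.1 Prop. 1 and §2.6] -/
theorem two_le_serreWeightLocal_of_exists (H : ρ.exists_isSerreWeight ι) :
    ρ.two_le_serreWeightLocal ι := by
  intro _
  exact two_le_of_isSerreWeight (isSerreWeight_serreWeightLocal_of ρ ι H)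

/-- Conversely, the lower bound `2 ≤ k(ρ̄_F)` forces the existence of an inertia shape:
`serreWeightLocal` is the junk value `sInf ∅ = 0` when no case of the recipe applies, so
`2 ≤ serreWeightLocal` makes the relevant set of weights non-empty (`Nat.nonempty_of_pos_sInf`).
[folklore] -/
theorem exists_isSerreWeight_of_two_le_serreWeightLocal (H : ρ.two_le_serreWeightLocal ι) :
    ρ.exists_isSerreWeight ι := by
  intro _
  have h2 : 2 ≤ ρ.serreWeightLocal ι := H
  unfold serreWeightLocal at h2
  split_ifs at h2 with h₂ ht
  · obtain ⟨m, hm⟩ := h₂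
    exact ⟨m, hm.isSerreWeight⟩
  · obtain ⟨m, hm⟩ := Nat.nonempty_of_pos_sInf (lt_of_lt_of_le two_pos h2)
    exact ⟨m, IsLevelOneTameWeight.isSerreWeight hm⟩
  · obtain ⟨m, hm⟩ := Nat.nonempty_of_pos_sInf (lt_of_lt_of_le two_pos h2)
    exact ⟨m, IsLevelOneWildWeight.isSerreWeight hm⟩

/-- **`two_le_serreWeightLocal ↔ exists_isSerreWeight`**: for the weight as formalised in the
parent file (junk value `0` outside the three cases), the lower bound of §2.6 is *equivalent* to
the existence statement of Serre's Prop. 1 (some case of the recipe applies).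
Ref: Serre, Duke Math. J. 54 (1987), §2.1 Prop. 1; §2.6.
[cite: Serre1987, §2.1 Prop. 1 and §2.6] -/
theorem two_le_serreWeightLocal_iff_exists_isSerreWeight :
    ρ.two_le_serreWeightLocal ι ↔ ρ.exists_isSerreWeight ι :=
  ⟨exists_isSerreWeight_of_two_le_serreWeightLocal ρ ι, two_le_serreWeightLocal_of_exists ρ ι⟩

/-- In particular a positive weight already forces `2 ≤ k(ρ̄_F)`: `0 < serreWeightLocal`
excludes the junk value, so some case applies and `two_le_of_isSerreWeight` gives the bound.
[folklore] -/
theorem two_le_serreWeightLocal_of_pos [DiscreteTopology k] (h : 0 < ρ.serreWeightLocal ι) :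
    2 ≤ ρ.serreWeightLocal ι := by
  have H : ρ.exists_isSerreWeight ι := by
    intro _
    unfold serreWeightLocal at h
    split_ifs at h with h₂ ht
    · obtain ⟨m, hm⟩ := h₂
      exact ⟨m, hm.isSerreWeight⟩
    · obtain ⟨m, hm⟩ := Nat.nonempty_of_pos_sInf h
      exact ⟨m, IsLevelOneTameWeight.isSerreWeight hm⟩
    · obtain ⟨m, hm⟩ := Nat.nonempty_of_pos_sInf h
      exact ⟨m, IsLevelOneWildWeight.isSerreWeight hm⟩
  exact two_le_serreWeightLocal_of_exists ρ ι H

/-- Global form: `2 ≤ k(ρ̄)` for `ρ̄ : Γ_ℚ → GL₂(k)` at any local restriction datum, from the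
existence of an inertia shape for the local restriction.
Ref: Serre, Duke Math. J. 54 (1987), §2.6. [cite: Serre1987, §2.6 (Valeurs de k)] -/
theorem two_le_serreWeight_of {k : Type v} [Field k] [TopologicalSpace k] [DiscreteTopology k]
    (p : ℕ) (ρ : ModPGaloisRep ℚ k 2) (loc : LocalRestrictionAt p ρ)
    (ι : absIntegers 𝒪[loc.F] loc.F ⧸ absMaximalIdeal loc.F →+* k)
    (H : loc.rep.exists_isSerreWeight ι) :
    2 ≤ serreWeight p ρ loc ι :=
  two_le_serreWeightLocal_of_exists loc.rep ι H

end TwoLe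

/-! ### Linear algebra of `2 × 2` matrices over a field

Elementary lemmas used to put `ρ̄(I_F)` in triangular or diagonal form: a change of basis
`Q ∈ GL₂(k)` with prescribed columns, and the shape of `Q⁻¹ M Q` when the columns of `Q` are
eigenvectors of `M`. -/

namespace InertiaShape

section LinearAlgebra

variable {k : Type v} [Field k]

/-- Two vectors `w₁, w₂ ∈ k²` with `w₁ 0 * w₂ 1 - w₂ 0 * w₁ 1 ≠ 0` are the columns of an
invertible matrix `Q`: `Q e₀ = w₁`, `Q e₁ = w₂`. [folklore] -/
theorem exists_gl_mulVec_single_eq (w₁ w₂ : Fin 2 → k) (h : w₁ 0 * w₂ 1 - w₂ 0 * w₁ 1 ≠ 0) :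
    ∃ Q : GL (Fin 2) k, (Q : Matrix (Fin 2) (Fin 2) k) *ᵥ Pi.single 0 1 = w₁ ∧
      (Q : Matrix (Fin 2) (Fin 2) k) *ᵥ Pi.single 1 1 = w₂ := by
  refine ⟨Matrix.GeneralLinearGroup.mkOfDetNeZero !![w₁ 0, w₂ 0; w₁ 1, w₂ 1]
    (by rw [Matrix.det_fin_two_of]; exact h), ?_, ?_⟩
  · ext i
    fin_cases i <;> simp [Matrix.GeneralLinearGroup.mkOfDetNeZero, Matrix.mulVec, dotProduct,
      Fin.sum_univ_two]
  · ext i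
    fin_cases i <;> simp [Matrix.GeneralLinearGroup.mkOfDetNeZero, Matrix.mulVec, dotProduct,
      Fin.sum_univ_two]

/-- A non-zero vector `w ∈ k²` is the first column of an invertible matrix. [folklore] -/
theorem exists_gl_mulVec_single_zero_eq (w : Fin 2 → k) (hw : w ≠ 0) :
    ∃ Q : GL (Fin 2) k, (Q : Matrix (Fin 2) (Fin 2) k) *ᵥ Pi.single 0 1 = w := by
  by_cases h0 : w 0 = 0
  · have h1 : w 1 ≠ 0 := by
      intro h1; apply hw; ext i; fin_cases i <;> simp [h0, h1]
    obtain ⟨Q, hQ, -⟩ := exists_gl_mulVec_single_eq w (Pi.single 0 1) (by simp [h0, h1])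
    exact ⟨Q, hQ⟩
  · obtain ⟨Q, hQ, -⟩ := exists_gl_mulVec_single_eq w (Pi.single 1 1) (by simp [h0])
    exact ⟨Q, hQ⟩

/-- Two vectors `v ≠ 0`, `u` of `k²` with `v 0 * u 1 - u 0 * v 1 = 0` are proportional. [folklore] -/
theorem exists_eq_smul_of_det_eq_zero {v u : Fin 2 → k} (hv : v ≠ 0)
    (hdet : v 0 * u 1 - u 0 * v 1 = 0) : ∃ c : k, u = c • v := by
  by_cases hv0 : v 0 = 0
  · have hv1 : v 1 ≠ 0 := by
      intro hv1; apply hv; ext i; fin_cases i <;> simp [hv0, hv1]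
    have hu0 : u 0 = 0 := by
      rw [hv0, zero_mul, zero_sub, neg_eq_zero] at hdet
      exact (mul_eq_zero.mp hdet).resolve_right hv1
    refine ⟨u 1 / v 1, ?_⟩
    ext i; fin_cases i
    · simp [hv0, hu0]
    · simp [div_mul_cancel₀ _ hv1]
  · refine ⟨u 0 / v 0, ?_⟩
    ext i; fin_cases i
    · simp [div_mul_cancel₀ _ hv0]
    · change u 1 = u 0 / v 0 * v 1
      field_simp
      linear_combination hdet

/-- The determinant of `M - l • 1` for a `2 × 2` matrix. [folklore] -/
theorem det_sub_smul_one (M : Matrix (Fin 2) (Fin 2) k) (l : k) :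
    (M - l • (1 : Matrix (Fin 2) (Fin 2) k)).det = l ^ 2 - M.trace * l + M.det := by
  simp [Matrix.det_fin_two, Matrix.trace_fin_two]
  ring

/-- Powers of a matrix with zero off-diagonal entries have zero off-diagonal entries. [folklore] -/
theorem pow_apply_offDiag {D : Matrix (Fin 2) (Fin 2) k} (h10 : D 1 0 = 0) (h01 : D 0 1 = 0) (j : ℕ) :
    (D ^ j) 1 0 = 0 ∧ (D ^ j) 0 1 = 0 := by
  induction j with
  | zero => simp
  | succ j ih =>
    rw [pow_succ]
    constructor
    · simp [Matrix.mul_apply, Fin.sum_univ_two, ih.1, h10]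
    · simp [Matrix.mul_apply, Fin.sum_univ_two, ih.2, h01]

/-- If a non-zero `2 × 2` matrix `m` kills a non-zero vector `v` and a vector `u`, then `u` is a
multiple of `v` (the kernel of `m` is the line `k v`). [folklore] -/
theorem exists_eq_smul_of_mulVec_eq_zero {m : Matrix (Fin 2) (Fin 2) k} (hm : m ≠ 0)
    {v u : Fin 2 → k} (hv : v ≠ 0) (hmv : m *ᵥ v = 0) (hmu : m *ᵥ u = 0) :
    ∃ c : k, u = c • v := by
  -- the matrix `Q = [v | u]` satisfies `m * Q = 0`, so it is not invertible
  have hdet : v 0 * u 1 - u 0 * v 1 = 0 := by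
    by_contra hdet
    obtain ⟨Q, hQ0, hQ1⟩ := exists_gl_mulVec_single_eq v u hdet
    apply hm
    have hmQ : m * (Q : Matrix (Fin 2) (Fin 2) k) = 0 := by
      ext i j
      fin_cases j
      · have := congrFun hmv i
        rw [← hQ0, Matrix.mulVec_mulVec, Matrix.mulVec_single_one] at this
        simpa using this
      · have := congrFun hmu i
        rw [← hQ1, Matrix.mulVec_mulVec, Matrix.mulVec_single_one] at this
        simpa using this
    calc m = m * (Q : Matrix (Fin 2) (Fin 2) k) * ((Q⁻¹ : GL (Fin 2) k) : Matrix (Fin 2) (Fin 2) k) := by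
            rw [Matrix.mul_assoc, ← Matrix.GeneralLinearGroup.coe_mul, mul_inv_cancel,
              Matrix.GeneralLinearGroup.coe_one, Matrix.mul_one]
      _ = 0 := by rw [hmQ, Matrix.zero_mul]
  by_cases hv0 : v 0 = 0
  · have hv1 : v 1 ≠ 0 := by
      intro hv1; apply hv; ext i; fin_cases i <;> simp [hv0, hv1]
    have hu0 : u 0 = 0 := by
      rw [hv0, zero_mul, zero_sub, neg_eq_zero] at hdet
      exact (mul_eq_zero.mp hdet).resolve_right hv1
    refine ⟨u 1 / v 1, ?_⟩
    ext i; fin_cases i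
    · simp [hv0, hu0]
    · simp [div_mul_cancel₀ _ hv1]
  · refine ⟨u 0 / v 0, ?_⟩
    ext i; fin_cases i
    · simp [div_mul_cancel₀ _ hv0]
    · change u 1 = u 0 / v 0 * v 1
      field_simp
      linear_combination hdet

/-- If the first column `w = Q e₀` of `Q` is an eigenvector of `M` with eigenvalue `c`, then
`Q⁻¹ M Q` has first column `(c, 0)`. [folklore] -/
theorem conj_mulVec_single_zero {Q : GL (Fin 2) k} {M : Matrix (Fin 2) (Fin 2) k} {w : Fin 2 → k}
    {c : k} (hQ : (Q : Matrix (Fin 2) (Fin 2) k) *ᵥ Pi.single 0 1 = w) (hM : M *ᵥ w = c • w) :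
    (((Q⁻¹ : GL (Fin 2) k) : Matrix (Fin 2) (Fin 2) k) * M * (Q : Matrix (Fin 2) (Fin 2) k)) *ᵥ
        Pi.single 0 1 = c • Pi.single 0 1 := by
  rw [← Matrix.mulVec_mulVec, ← Matrix.mulVec_mulVec, hQ, hM, Matrix.mulVec_smul, ← hQ,
    Matrix.mulVec_mulVec, ← Matrix.GeneralLinearGroup.coe_mul, inv_mul_cancel,
    Matrix.GeneralLinearGroup.coe_one, Matrix.one_mulVec]

/-- Same for the second column. [folklore] -/
theorem conj_mulVec_single_one {Q : GL (Fin 2) k} {M : Matrix (Fin 2) (Fin 2) k} {w : Fin 2 → k}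
    {c : k} (hQ : (Q : Matrix (Fin 2) (Fin 2) k) *ᵥ Pi.single 1 1 = w) (hM : M *ᵥ w = c • w) :
    (((Q⁻¹ : GL (Fin 2) k) : Matrix (Fin 2) (Fin 2) k) * M * (Q : Matrix (Fin 2) (Fin 2) k)) *ᵥ
        Pi.single 1 1 = c • Pi.single 1 1 := by
  rw [← Matrix.mulVec_mulVec, ← Matrix.mulVec_mulVec, hQ, hM, Matrix.mulVec_smul, ← hQ,
    Matrix.mulVec_mulVec, ← Matrix.GeneralLinearGroup.coe_mul, inv_mul_cancel,
    Matrix.GeneralLinearGroup.coe_one, Matrix.one_mulVec]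

/-- Entries of a matrix whose `j`-th column is `c e_j`. [folklore] -/
theorem apply_of_mulVec_single_eq_smul {A : Matrix (Fin 2) (Fin 2) k} {j : Fin 2} {c : k}
    (h : A *ᵥ Pi.single j 1 = c • Pi.single j 1) (i : Fin 2) :
    A i j = if i = j then c else 0 := by
  have := congrFun h i
  rw [Matrix.mulVec_single_one] at this
  change A i j = _ at this
  rw [this, Pi.smul_apply, Pi.single_apply, smul_eq_mul, mul_ite, mul_one, mul_zero]

/-- Powers of a matrix act on an eigenvector by powers of the eigenvalue. [folklore] -/
theorem pow_mulVec_of_mulVec_eq_smul {M : Matrix (Fin 2) (Fin 2) k} {v : Fin 2 → k} {c : k}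
    (h : M *ᵥ v = c • v) (n : ℕ) : (M ^ n) *ᵥ v = c ^ n • v := by
  induction n with
  | zero => simp
  | succ n ih => rw [pow_succ, ← Matrix.mulVec_mulVec, h, Matrix.mulVec_smul, ih, smul_smul,
      pow_succ']

/-- The permutation matrix `J = !![0, 1; 1, 0] ∈ GL₂(k)`. [folklore] -/
def swapGL : GL (Fin 2) k :=
  Matrix.GeneralLinearGroup.mkOfDetNeZero !![0, 1; 1, 0] (by rw [Matrix.det_fin_two_of]; simp)

/-- `J⁻¹ = J`. [folklore] -/
theorem swapGL_inv : (swapGL : GL (Fin 2) k)⁻¹ = swapGL := by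
  refine inv_eq_of_mul_eq_one_right (Units.ext ?_)
  rw [Units.val_mul, Units.val_one]
  ext i j
  fin_cases i <;> fin_cases j <;>
    simp [swapGL, Matrix.GeneralLinearGroup.mkOfDetNeZero, Matrix.mul_apply, Fin.sum_univ_two]

/-- Conjugating a diagonal matrix by `J` swaps the diagonal entries. [folklore] -/
theorem swapGL_conj_diag (x y : k) :
    ((swapGL : GL (Fin 2) k) : Matrix (Fin 2) (Fin 2) k) * !![x, 0; 0, y] *
        (((swapGL : GL (Fin 2) k)⁻¹ : GL (Fin 2) k) : Matrix (Fin 2) (Fin 2) k) = !![y, 0; 0, x] := by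
  rw [swapGL_inv]
  ext i j
  fin_cases i <;> fin_cases j <;>
    simp [swapGL, Matrix.GeneralLinearGroup.mkOfDetNeZero, Matrix.mul_apply, Fin.sum_univ_two]

end LinearAlgebra

/-! ### Characters from a triangular matrix representation -/

section Characters

variable {k : Type v} [Field k] {G : Type*} [Group G]

/-- The diagonal entries of a homomorphism `f : G → GL₂(k)` with values in upper triangular
matrices are multiplicative. [folklore] -/
def diagEntryHom (f : G →* GL (Fin 2) k) (hf : ∀ g, (f g : Matrix (Fin 2) (Fin 2) k) 1 0 = 0)
    (i : Fin 2) : G →* k where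
  toFun g := (f g : Matrix (Fin 2) (Fin 2) k) i i
  map_one' := by rw [map_one, Matrix.GeneralLinearGroup.coe_one, Matrix.one_apply_eq]
  map_mul' g h := by
    rw [map_mul, Matrix.GeneralLinearGroup.coe_mul]
    fin_cases i
    · simp [Matrix.mul_apply, Fin.sum_univ_two, hf h]
    · simp [Matrix.mul_apply, Fin.sum_univ_two, hf g]

/-- The **diagonal characters** `χ_i : G → kˣ` (`i = 0, 1`) of a homomorphism into upper
triangular matrices.  Ref: Serre, Duke Math. J. 54 (1987), §2.1 (the characters `φ, φ'`
giving the action of `I` on `V^{ss}`). [folklore] -/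
def diagChar (f : G →* GL (Fin 2) k) (hf : ∀ g, (f g : Matrix (Fin 2) (Fin 2) k) 1 0 = 0)
    (i : Fin 2) : G →* kˣ :=
  (diagEntryHom f hf i).toHomUnits

/-- Unfolding lemma for `diagChar`. [folklore] -/
@[simp] theorem coe_diagChar_apply (f : G →* GL (Fin 2) k)
    (hf : ∀ g, (f g : Matrix (Fin 2) (Fin 2) k) 1 0 = 0) (i : Fin 2) (g : G) :
    (diagChar f hf i g : k) = (f g : Matrix (Fin 2) (Fin 2) k) i i :=
  rfl

/-- An upper triangular `f g` is `!![χ₀ g, *; 0, χ₁ g]`. [folklore] -/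
theorem eq_of_diagChar (f : G →* GL (Fin 2) k)
    (hf : ∀ g, (f g : Matrix (Fin 2) (Fin 2) k) 1 0 = 0) (g : G) :
    (f g : Matrix (Fin 2) (Fin 2) k) =
      !![(diagChar f hf 0 g : k), (f g : Matrix (Fin 2) (Fin 2) k) 0 1; 0, (diagChar f hf 1 g : k)] := by
  rw [Matrix.eta_fin_two (f g : Matrix (Fin 2) (Fin 2) k), hf g]
  rfl

/-- In a field of characteristic `p`, `x ^ (p ^ s * d) = 1` forces `x ^ d = 1`
(`(x^d - 1)^{p^s} = x^{d p^s} - 1`). [folklore] -/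
theorem pow_eq_one_of_pow_mul_eq_one {p : ℕ} [Fact p.Prime] [CharP k p] {x : k} {s d : ℕ}
    (h : x ^ (p ^ s * d) = 1) : x ^ d = 1 := by
  have h' : (x ^ d - 1) ^ p ^ s = 0 := by
    rw [sub_pow_char_pow, one_pow, ← pow_mul, mul_comm, h, sub_self]
  exact sub_eq_zero.mp (pow_eq_zero_iff (pow_ne_zero _ (Fact.out : p.Prime).ne_zero) |>.mp h')

/-- A character with values in a finite subgroup... more precisely: if `χ g ^ N = 1` for all `g`
with `N ≠ 0`, then `χ g ^ d = 1` for the prime-to-`p` part `d` of `N` (`k` of characteristic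
`p`): `kˣ` has no `p`-torsion. [folklore] -/
theorem exists_pow_eq_one_not_dvd {p : ℕ} [Fact p.Prime] [CharP k p] (χ : G →* kˣ) {N : ℕ}
    (hN : N ≠ 0) (h : ∀ g, χ g ^ N = 1) :
    ∃ d : ℕ, 0 < d ∧ ¬ p ∣ d ∧ ∀ g, χ g ^ d = 1 := by
  obtain ⟨s, d, hpd, rfl⟩ := Nat.exists_eq_pow_mul_and_not_dvd hN p (Fact.out : p.Prime).ne_one
  refine ⟨d, Nat.pos_of_ne_zero (by rintro rfl; simp at hN), hpd, fun g => ?_⟩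
  have := h g
  rw [Units.ext_iff, Units.val_pow_eq_pow_val, Units.val_one] at this ⊢
  exact pow_eq_one_of_pow_mul_eq_one this

end Characters

/-! ### The wild case: the fixed line of `ρ̄(I_F^{v₀})` (Serre §2.4, (2.4.1)) -/

section Wild

variable {F : Type u} [Field F] [ValuativeRel F] [TopologicalSpace F] [IsNonarchimedeanLocalField F]
variable {k : Type v} [Field k] [TopologicalSpace k]

/-- **The wild case (Serre, §2.4): a common eigenvector.**  If `ρ̄` is not tamely ramified
(`k` discrete, finite image), then there is a non-zero `v ∈ k²` which is an eigenvector of every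
`ρ̄(g)`, `g ∈ Γ_F`: take `v` spanning the fixed line of the non-trivial normal `p`-subgroup
`W = ρ̄(I_F^{v₀})` (Serre: "les éléments de `V` fixés par `I_p` forment alors une droite `D`,
qui est stable par `G_p`").  Proof: a central `z ≠ 1` of the `p`-group `W` is unipotent, its
fixed vectors form a line `k v` preserved by `W`, on which `W` acts through characters of
`p`-power order, i.e. trivially; the fixed line of `W` is then stable under the normaliser
`ρ̄(Γ_F)` of `W`.
Ref: Serre, Duke Math. J. 54 (1987), §2.4, (2.4.1); Serre, Invent. Math. 15 (1972), §1.6,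
Prop. 4 (proof). [cite: Serre1987, §2.4 (2.4.1)] -/
theorem exists_common_eigenvector_of_not_isTamelyRamified [DiscreteTopology k]
    (hfin : ModPGaloisRep.finite_range (K := F) (k := k) (n := 2))
    (hN1 : absUpperInertia_map_isPGroup F (GL (Fin 2) k))
    (ρ : ModPGaloisRep F k 2) (ι : absIntegers 𝒪[F] F ⧸ absMaximalIdeal F →+* k)
    (hw : ¬ ρ.IsTamelyRamified) :
    ∃ v : Fin 2 → k, v ≠ 0 ∧ ∀ g : absoluteGaloisGroup F, ∃ c : k,
      ((ρ g : GL (Fin 2) k) : Matrix (Fin 2) (Fin 2) k) *ᵥ v = c • v := by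
  classical
  haveI : Fact (ringChar 𝓀[F]).Prime := ⟨ringChar_residueField_prime⟩
  haveI : CharP k (ringChar 𝓀[F]) := charP_of_residueEmbedding ι
  -- a wild element `σ₀ ∈ I_F^{v₀}`, `v₀ > 0`, `ρ σ₀ ≠ 1`
  obtain ⟨v₀, hv₀, σ₀, hσ₀, hρσ₀⟩ :
      ∃ v₀ : ℝ, 0 < v₀ ∧ ∃ σ₀ ∈ absUpperInertia F v₀, ρ σ₀ ≠ 1 := by
    by_contra hcon
    push Not at hcon
    exact hw fun v hv σ hσ => hcon v hv σ hσ
  -- `W = ρ(I_F^{v₀})`, a finite non-trivial `p`-group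
  set W : Subgroup (GL (Fin 2) k) := (absUpperInertia F v₀).map ρ.toMonoidHom with hW
  have hWp : IsPGroup (ringChar 𝓀[F]) W := hN1 ρ hv₀
  haveI : Finite W := by
    have hsub : (W : Set (GL (Fin 2) k)) ⊆ Set.range ρ := by
      rintro _ ⟨σ, -, rfl⟩; exact ⟨σ, rfl⟩
    exact ((hfin ρ).subset hsub).to_subtype
  have hσ₀W : ρ σ₀ ∈ W := ⟨σ₀, hσ₀, rfl⟩
  haveI : Nontrivial W := ⟨⟨⟨ρ σ₀, hσ₀W⟩, 1, fun h => hρσ₀ (congrArg Subtype.val h)⟩⟩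
  -- a central `z ≠ 1`
  haveI : Nontrivial (Subgroup.center W) := hWp.center_nontrivial
  obtain ⟨⟨z, hzc⟩, hz1⟩ := exists_ne (1 : Subgroup.center W)
  have hz1' : (z : GL (Fin 2) k) ≠ 1 := fun h => hz1 (Subtype.ext (Subtype.ext h))
  have hzc' : ∀ w ∈ W, w * (z : GL (Fin 2) k) = z * w := fun w hw => by
    have := Subgroup.mem_center_iff.mp hzc ⟨w, hw⟩
    exact congrArg Subtype.val this
  -- `m = z - 1 ≠ 0` is nilpotent
  set m : Matrix (Fin 2) (Fin 2) k := ((z : GL (Fin 2) k) : Matrix (Fin 2) (Fin 2) k) - 1 with hm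
  have hm0 : m ≠ 0 := by
    intro h
    apply hz1'
    exact Units.ext (sub_eq_zero.mp h)
  obtain ⟨s, hs⟩ := hWp z
  have hzs : ((z : GL (Fin 2) k) : Matrix (Fin 2) (Fin 2) k) ^ ringChar 𝓀[F] ^ s = 1 := by
    have := congrArg (fun x : W => ((x : GL (Fin 2) k) : Matrix (Fin 2) (Fin 2) k)) hs
    simpa using this
  have hms : m ^ ringChar 𝓀[F] ^ s = 0 := by
    rw [hm, sub_pow_char_pow_of_commute (p := ringChar 𝓀[F]) (n := s) (h := Commute.one_right _), hzs,
      one_pow, sub_self]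
  have hmdet : m.det = 0 := by
    have : m.det ^ ringChar 𝓀[F] ^ s = 0 := by rw [← Matrix.det_pow, hms, Matrix.det_zero]
    exact pow_eq_zero_iff (pow_ne_zero _ (Fact.out : (ringChar 𝓀[F]).Prime).ne_zero) |>.mp this
  -- the fixed line `k v` of `z`
  obtain ⟨v, hv, hmv⟩ := Matrix.exists_mulVec_eq_zero_iff.mpr hmdet
  have hzv : ((z : GL (Fin 2) k) : Matrix (Fin 2) (Fin 2) k) *ᵥ v = v := by
    have := hmv; rw [hm, Matrix.sub_mulVec, Matrix.one_mulVec, sub_eq_zero] at this; exact this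
  -- every `w ∈ W` fixes `v`
  have hWv : ∀ w ∈ W, (w : Matrix (Fin 2) (Fin 2) k) *ᵥ v = v := by
    intro w hw
    -- `w v` is fixed by `z` (as `w z = z w`), hence a multiple of `v`
    have hcomm : (w : Matrix (Fin 2) (Fin 2) k) * m = m * (w : Matrix (Fin 2) (Fin 2) k) := by
      have h := congrArg (fun x : GL (Fin 2) k => (x : Matrix (Fin 2) (Fin 2) k)) (hzc' w hw)
      simp only [Matrix.GeneralLinearGroup.coe_mul] at h
      rw [hm, mul_sub, sub_mul, mul_one, one_mul, h]
    have hmwv : m *ᵥ ((w : Matrix (Fin 2) (Fin 2) k) *ᵥ v) = 0 := by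
      rw [Matrix.mulVec_mulVec, ← hcomm, ← Matrix.mulVec_mulVec, hmv, Matrix.mulVec_zero]
    obtain ⟨c, hc⟩ := exists_eq_smul_of_mulVec_eq_zero hm0 hv hmv hmwv
    -- `c` is a `p`-power root of unity, hence `1`
    obtain ⟨t, ht⟩ := hWp ⟨w, hw⟩
    have hwt : (w : Matrix (Fin 2) (Fin 2) k) ^ ringChar 𝓀[F] ^ t = 1 := by
      have := congrArg (fun x : W => ((x : GL (Fin 2) k) : Matrix (Fin 2) (Fin 2) k)) ht
      simpa using this
    have hct : c ^ (ringChar 𝓀[F] ^ t * 1) = 1 := by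
      rw [mul_one]
      have h1 := pow_mulVec_of_mulVec_eq_smul hc (ringChar 𝓀[F] ^ t)
      rw [hwt, Matrix.one_mulVec] at h1
      have h2 : (c ^ ringChar 𝓀[F] ^ t - 1) • v = 0 := by rw [sub_smul, one_smul, ← h1, sub_self]
      exact sub_eq_zero.mp ((smul_eq_zero.mp h2).resolve_right hv)
    have hc1 : c = 1 := by simpa using pow_eq_one_of_pow_mul_eq_one hct
    rw [hc, hc1, one_smul]
  -- `ρ(g) v` is again fixed by `W` (normality), hence a multiple of `v`
  refine ⟨v, hv, fun g => ?_⟩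
  have hfix : ((z : GL (Fin 2) k) : Matrix (Fin 2) (Fin 2) k) *ᵥ
      (((ρ g : GL (Fin 2) k) : Matrix (Fin 2) (Fin 2) k) *ᵥ v) =
      ((ρ g : GL (Fin 2) k) : Matrix (Fin 2) (Fin 2) k) *ᵥ v := by
    obtain ⟨σz, hσz, hz⟩ := (z : W).2
    have hconj : g⁻¹ * σz * g⁻¹⁻¹ ∈ absUpperInertia F v₀ := (absUpperInertia_normal F v₀).conj_mem σz hσz g⁻¹
    rw [inv_inv] at hconj
    have hW' : ρ.toMonoidHom (g⁻¹ * σz * g) ∈ W := ⟨_, hconj, rfl⟩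
    have key : (z : GL (Fin 2) k) * ρ.toMonoidHom g = ρ.toMonoidHom g * ρ.toMonoidHom (g⁻¹ * σz * g) := by
      rw [← hz, ← map_mul, ← map_mul, ← mul_assoc, ← mul_assoc, mul_inv_cancel, one_mul]
    have key' := congrArg (fun x : GL (Fin 2) k => (x : Matrix (Fin 2) (Fin 2) k) *ᵥ v) key
    simp only [Matrix.GeneralLinearGroup.coe_mul, ← Matrix.mulVec_mulVec] at key'
    rw [hWv _ hW'] at key'
    exact key'
  have hmu : m *ᵥ (((ρ g : GL (Fin 2) k) : Matrix (Fin 2) (Fin 2) k) *ᵥ v) = 0 := by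
    rw [hm, Matrix.sub_mulVec, Matrix.one_mulVec, hfix, sub_self]
  exact exists_eq_smul_of_mulVec_eq_zero hm0 hv hmv hmu

omit [ValuativeRel F] [TopologicalSpace F] [IsNonarchimedeanLocalField F] in
/-- A common eigenvector of `ρ̄(Γ_F)` puts `ρ̄` in upper triangular form: for `Q` with first
column `v` and `P = Q⁻¹`, every `P ρ̄(g) P⁻¹` has `(1,0)` entry `0`. [folklore] -/
theorem exists_conj_triangular (ρ : ModPGaloisRep F k 2) {v : Fin 2 → k} (hv : v ≠ 0)
    (h : ∀ g : absoluteGaloisGroup F, ∃ c : k,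
      ((ρ g : GL (Fin 2) k) : Matrix (Fin 2) (Fin 2) k) *ᵥ v = c • v) :
    ∃ P : GL (Fin 2) k, ∀ g : absoluteGaloisGroup F,
      ((P * ρ g * P⁻¹ : GL (Fin 2) k) : Matrix (Fin 2) (Fin 2) k) 1 0 = 0 := by
  obtain ⟨Q, hQ⟩ := exists_gl_mulVec_single_zero_eq v hv
  refine ⟨Q⁻¹, fun g => ?_⟩
  obtain ⟨c, hc⟩ := h g
  have h1 := conj_mulVec_single_zero (M := ((ρ g : GL (Fin 2) k) : Matrix (Fin 2) (Fin 2) k)) hQ hc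
  have h2 := apply_of_mulVec_single_eq_smul h1 1
  rw [inv_inv, Matrix.GeneralLinearGroup.coe_mul, Matrix.GeneralLinearGroup.coe_mul]
  simpa using h2

end Wild

/-! ### The tame case: diagonalisation of the cyclic group `ρ̄(I_F)` (Serre §2.1–2.3) -/

section Tame

variable {F : Type u} [Field F] [ValuativeRel F] [TopologicalSpace F] [IsNonarchimedeanLocalField F]
variable {k : Type v} [Field k] [TopologicalSpace k]

open Polynomial in
/-- **The tame case: `ρ̄(I_F)` is diagonalisable over `k`.**  If `ρ̄` is tamely ramified then
`ρ̄(I_F)` is cyclic of order `N` prime to `p` (`absInertia_map_isCyclic`), generated by some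
`g₀`; as `k` contains a primitive `N`-th root of unity (`exists_isPrimitiveRoot_of_not_dvd`),
`X^N - 1` splits into distinct linear factors over `k`, so `g₀` — whose minimal polynomial
divides `X^N - 1` — is diagonalisable over `k`, and with it all of `ρ̄(I_F)`.  (Serre: "cette
action de `I_t` est diagonalisable; elle est donnée par deux caractères `φ, φ'`".)  The `2 × 2`
argument: divide `X^N - 1` by the characteristic polynomial `c` of `g₀`; by Cayley–Hamilton
the remainder `r₁ X + r₀` kills `g₀`, so either `g₀` is scalar (`r₁ ≠ 0`) or `c ∣ X^N - 1`,
in which case `c` has a root `ζ^i ∈ k` (a polynomial of degree `N - 2` cannot vanish at the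
`N` distinct `ζ^i`), two distinct roots by separability, and two independent eigenvectors.
Ref: Serre, Duke Math. J. 54 (1987), §2.1; Serre, Invent. Math. 15 (1972), §1.6 ("l'image de
`I_t` par `ρ` est un groupe cyclique d'ordre premier à `p` … on peut mettre `ρ(I_t)` sous
forme diagonale"). [cite: Serre1987, §2.1] [cite: SerreInventiones1972, §1.6] -/
theorem exists_conj_diagonal_of_isTamelyRamified [DiscreteTopology k]
    (hN3 : absInertia_map_isCyclic F (GL (Fin 2) k))
    (ρ : ModPGaloisRep F k 2) (ι : absIntegers 𝒪[F] F ⧸ absMaximalIdeal F →+* k)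
    (ht : ρ.IsTamelyRamified) :
    ∃ P : GL (Fin 2) k, ∀ σ : absInertia F,
      ((P * ρ (σ : absoluteGaloisGroup F) * P⁻¹ : GL (Fin 2) k) : Matrix (Fin 2) (Fin 2) k) 1 0 = 0 ∧
      ((P * ρ (σ : absoluteGaloisGroup F) * P⁻¹ : GL (Fin 2) k) : Matrix (Fin 2) (Fin 2) k) 0 1 = 0 := by
  classical
  haveI : Fact (ringChar 𝓀[F]).Prime := ⟨ringChar_residueField_prime⟩
  haveI : CharP k (ringChar 𝓀[F]) := charP_of_residueEmbedding ι
  obtain ⟨hcyc, hcop⟩ := hN3 ρ ht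
  set H : Subgroup (GL (Fin 2) k) := (absInertia F).map ρ.toMonoidHom with hH
  obtain ⟨g₀, hg₀⟩ := (Subgroup.isCyclic_iff_exists_zpowers_eq_top H).mp hcyc
  -- the order `N` of `g₀`
  set N := Nat.card H with hNdef
  have hNord : orderOf g₀ = N := by rw [hNdef, ← hg₀, Nat.card_zpowers]
  have hpN : ¬ ringChar 𝓀[F] ∣ N := fun h =>
    (Fact.out : (ringChar 𝓀[F]).Prime).ne_one (Nat.Coprime.eq_one_of_dvd hcop.symm h)
  have hN0 : N ≠ 0 := by
    intro h0; apply hpN; rw [h0]; exact dvd_zero _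
  have hNpos : 0 < N := Nat.pos_of_ne_zero hN0
  have hg₀N : g₀ ^ N = 1 := by rw [← hNord]; exact pow_orderOf_eq_one g₀
  have hfin : IsOfFinOrder g₀ := isOfFinOrder_iff_pow_eq_one.mpr ⟨N, hNpos, hg₀N⟩
  -- every `ρ σ`, `σ ∈ I_F`, is a power of `g₀`
  have hpow : ∀ σ : absInertia F, ∃ j : ℕ, ρ (σ : absoluteGaloisGroup F) = g₀ ^ j := by
    intro σ
    have hmem : ρ.toMonoidHom σ ∈ Subgroup.zpowers g₀ := by rw [hg₀]; exact ⟨σ, σ.2, rfl⟩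
    obtain ⟨j, hj⟩ := (hfin.mem_powers_iff_mem_zpowers).mpr hmem
    exact ⟨j, hj.symm⟩
  -- it suffices to diagonalise `g₀`
  suffices hP : ∃ P : GL (Fin 2) k,
      ((P * g₀ * P⁻¹ : GL (Fin 2) k) : Matrix (Fin 2) (Fin 2) k) 1 0 = 0 ∧
      ((P * g₀ * P⁻¹ : GL (Fin 2) k) : Matrix (Fin 2) (Fin 2) k) 0 1 = 0 by
    obtain ⟨P, h10, h01⟩ := hP
    refine ⟨P, fun σ => ?_⟩
    obtain ⟨j, hj⟩ := hpow σ
    have : P * ρ (σ : absoluteGaloisGroup F) * P⁻¹ = (P * g₀ * P⁻¹) ^ j := by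
      rw [hj, ← MulAut.conj_apply, ← MulAut.conj_apply, map_pow]
    rw [this, Units.val_pow_eq_pow_val]
    exact pow_apply_offDiag h10 h01 j
  -- a primitive `N`-th root of unity in `k`
  obtain ⟨ζ, hζ⟩ := exists_isPrimitiveRoot_of_not_dvd ι hNpos hpN
  set M : Matrix (Fin 2) (Fin 2) k := (g₀ : Matrix (Fin 2) (Fin 2) k) with hM
  have hMN : M ^ N = 1 := by
    rw [hM, ← Units.val_pow_eq_pow_val, hg₀N, Units.val_one]
  -- divide `X ^ N - 1` by the characteristic polynomial
  set c : k[X] := M.charpoly with hc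
  have hcm : c.Monic := Matrix.charpoly_monic M
  have hcdeg : c.natDegree = 2 := by rw [hc, Matrix.charpoly_natDegree_eq_dim, Fintype.card_fin]
  have hc1 : c ≠ 1 := by intro h; rw [h, natDegree_one] at hcdeg; exact absurd hcdeg (by norm_num)
  have hceval : ∀ x : k, c.eval x = x ^ 2 - M.trace * x + M.det := by
    intro x; rw [hc, Matrix.charpoly_fin_two]; simp
  set f : k[X] := X ^ N - C 1 with hf
  have hfM : aeval M f = 0 := by
    rw [hf, map_sub, map_pow, aeval_X, aeval_C, map_one, hMN, sub_self]
  set r := f %ₘ c with hr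
  set h := f /ₘ c with hh
  have hdiv : r + c * h = f := modByMonic_add_div f c
  have hrdeg : r.natDegree ≤ 1 := by
    have := natDegree_modByMonic_lt f hcm hc1
    rw [← hr, hcdeg] at this
    omega
  have hrM : aeval M r = 0 := by
    have hcM : aeval M c = 0 := by rw [hc]; exact Matrix.aeval_self_charpoly M
    have := congrArg (aeval M) hdiv
    rw [map_add, map_mul, hfM, hcM, zero_mul, add_zero] at this
    exact this
  have hreq : r = C (r.coeff 1) * X + C (r.coeff 0) := eq_X_add_C_of_natDegree_le_one hrdeg
  have hrM' : r.coeff 1 • M + r.coeff 0 • (1 : Matrix (Fin 2) (Fin 2) k) = 0 := by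
    rw [hreq, map_add, map_mul, aeval_C, aeval_X, aeval_C, Algebra.algebraMap_eq_smul_one,
      Algebra.algebraMap_eq_smul_one, smul_mul_assoc, one_mul] at hrM
    exact hrM
  by_cases hr1 : r.coeff 1 = 0
  swap
  · -- `g₀` is scalar: `P = 1`
    have hMs : M = (-(r.coeff 0 / r.coeff 1)) • (1 : Matrix (Fin 2) (Fin 2) k) := by
      have : r.coeff 1 • M = -(r.coeff 0 • (1 : Matrix (Fin 2) (Fin 2) k)) :=
        eq_neg_of_add_eq_zero_left hrM'
      calc M = (r.coeff 1)⁻¹ • (r.coeff 1 • M) := by rw [smul_smul, inv_mul_cancel₀ hr1, one_smul]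
        _ = _ := by rw [this, smul_neg, smul_smul, neg_smul, div_eq_inv_mul]
    refine ⟨1, ?_, ?_⟩ <;>
    · rw [one_mul, inv_one, mul_one, ← hM, hMs]
      simp
  -- `c ∣ X ^ N - 1`
  have hr0 : r.coeff 0 = 0 := by
    rw [hr1, zero_smul, zero_add] at hrM'
    have := congrFun (congrFun hrM' 0) 0
    simpa using this
  have hr : r = 0 := by rw [hreq, hr1, hr0]; simp
  have hfc : f = c * h := by rw [← hdiv, hr, zero_add]
  have hf0 : f ≠ 0 := X_pow_sub_C_ne_zero hNpos 1
  have hh0 : h ≠ 0 := by intro h0; rw [h0, mul_zero] at hfc; exact hf0 hfc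
  have hc0 : c ≠ 0 := hcm.ne_zero
  have hhdeg : h.natDegree < N := by
    have h1 : f.natDegree = N := by rw [hf]; exact natDegree_X_pow_sub_C
    have h2 := natDegree_mul hc0 hh0
    rw [← hfc, h1, hcdeg] at h2
    omega
  -- a root `ζ ^ i` of `c`
  obtain ⟨i, hi⟩ : ∃ i : Fin N, c.eval (ζ ^ (i : ℕ)) = 0 := by
    by_contra hall
    push Not at hall
    apply hh0
    refine eq_zero_of_natDegree_lt_card_of_eval_eq_zero h (f := fun i : Fin N => ζ ^ (i : ℕ))
      (fun i j hij => Fin.ext (hζ.pow_inj i.2 j.2 hij)) (fun i => ?_) (by simpa using hhdeg)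
    have hfi : f.eval (ζ ^ (i : ℕ)) = 0 := by
      rw [hf, eval_sub, eval_pow, eval_X, eval_C, ← pow_mul, mul_comm, pow_mul, hζ.pow_eq_one,
        one_pow, sub_self]
    rw [hfc, eval_mul] at hfi
    exact (mul_eq_zero.mp hfi).resolve_left (hall i)
  set l₁ : k := ζ ^ (i : ℕ) with hl₁
  set l₂ : k := M.trace - l₁ with hl₂
  have hl₁c : l₁ ^ 2 - M.trace * l₁ + M.det = 0 := by rw [← hceval]; exact hi
  have hl₂c : l₂ ^ 2 - M.trace * l₂ + M.det = 0 := by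
    rw [hl₂]; linear_combination hl₁c
  -- the two roots are distinct (`X ^ N - 1` is separable)
  have hNk : (N : k) ≠ 0 := fun h0 => hpN ((CharP.cast_eq_zero_iff k (ringChar 𝓀[F]) N).mp h0)
  have h12 : l₁ ≠ l₂ := by
    intro heq
    have htr : M.trace = l₁ + l₁ := by rw [hl₂] at heq; linear_combination -heq
    have hdet : M.det = l₁ * l₁ := by linear_combination hl₁c + l₁ * htr
    have hcsq : c = (X - C l₁) ^ 2 := by
      rw [hc, Matrix.charpoly_fin_two, htr, hdet, C_add, C_mul]; ring
    have hsep : f.Separable := by rw [hf]; exact separable_X_pow_sub_C 1 hNk one_ne_zero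
    have hcsep : c.Separable := hsep.of_dvd ⟨h, hfc⟩
    rw [hcsq] at hcsep
    exact absurd (Separable.of_pow (not_isUnit_X_sub_C l₁) two_ne_zero hcsep).2 (by norm_num)
  -- eigenvectors
  have heig : ∀ l : k, l ^ 2 - M.trace * l + M.det = 0 →
      ∃ w : Fin 2 → k, w ≠ 0 ∧ M *ᵥ w = l • w := by
    intro l hl
    have hd : (M - l • (1 : Matrix (Fin 2) (Fin 2) k)).det = 0 := by rw [det_sub_smul_one]; exact hl
    obtain ⟨w, hw, hMw⟩ := Matrix.exists_mulVec_eq_zero_iff.mpr hd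
    refine ⟨w, hw, ?_⟩
    rwa [Matrix.sub_mulVec, Matrix.smul_mulVec, Matrix.one_mulVec, sub_eq_zero] at hMw
  obtain ⟨w₁, hw₁, hMw₁⟩ := heig l₁ hl₁c
  obtain ⟨w₂, hw₂, hMw₂⟩ := heig l₂ hl₂c
  have hind : w₁ 0 * w₂ 1 - w₂ 0 * w₁ 1 ≠ 0 := by
    intro h0
    obtain ⟨s, hs⟩ := exists_eq_smul_of_det_eq_zero hw₁ h0
    have h1 : M *ᵥ w₂ = l₁ • w₂ := by rw [hs, Matrix.mulVec_smul, hMw₁, smul_comm]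
    have h2 : (l₁ - l₂) • w₂ = 0 := by rw [sub_smul, ← h1, hMw₂, sub_self]
    exact h12 (sub_eq_zero.mp ((smul_eq_zero.mp h2).resolve_right hw₂))
  obtain ⟨Q, hQ0, hQ1⟩ := exists_gl_mulVec_single_eq w₁ w₂ hind
  refine ⟨Q⁻¹, ?_, ?_⟩
  · have h1 := apply_of_mulVec_single_eq_smul (conj_mulVec_single_zero hQ0 hMw₁) 1
    rw [inv_inv, Matrix.GeneralLinearGroup.coe_mul, Matrix.GeneralLinearGroup.coe_mul]
    simpa using h1
  · have h1 := apply_of_mulVec_single_eq_smul (conj_mulVec_single_one hQ1 hMw₂) 0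
    rw [inv_inv, Matrix.GeneralLinearGroup.coe_mul, Matrix.GeneralLinearGroup.coe_mul]
    simpa using h1

end Tame

/-! ### Diagonal characters of `ρ̄|I_F`: continuity, order, Frobenius action -/

section DiagonalCharacters

variable {F : Type u} [Field F] [ValuativeRel F] [TopologicalSpace F] [IsNonarchimedeanLocalField F]
variable {k : Type v} [Field k] [TopologicalSpace k]

/-- `σ ↦ P ρ̄(σ) P⁻¹` on `Γ_F`. [folklore] -/
def conjHom (ρ : ModPGaloisRep F k 2) (P : GL (Fin 2) k) : absoluteGaloisGroup F →* GL (Fin 2) k :=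
  (MulAut.conj P).toMonoidHom.comp ρ.toMonoidHom

/-- `σ ↦ P ρ̄(σ) P⁻¹` on `I_F`. [folklore] -/
def conjRestrict (ρ : ModPGaloisRep F k 2) (P : GL (Fin 2) k) : ↥(absInertia F) →* GL (Fin 2) k :=
  (conjHom ρ P).comp (absInertia F).subtype

omit [ValuativeRel F] [TopologicalSpace F] [IsNonarchimedeanLocalField F] in
/-- Unfolding lemma for `conjHom`. [folklore] -/
@[simp] theorem conjHom_apply (ρ : ModPGaloisRep F k 2) (P : GL (Fin 2) k) (g : absoluteGaloisGroup F) :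
    conjHom ρ P g = P * ρ g * P⁻¹ := rfl

/-- Unfolding lemma for `conjRestrict`. [folklore] -/
@[simp] theorem conjRestrict_apply (ρ : ModPGaloisRep F k 2) (P : GL (Fin 2) k) (σ : absInertia F) :
    conjRestrict ρ P σ = P * ρ (σ : absoluteGaloisGroup F) * P⁻¹ := rfl

/-- The diagonal characters of a triangularised `ρ̄|I_F` are continuous (`k` discrete: they
factor through the continuous `ρ̄` and the discrete group `GL₂(k)`). [folklore] -/
theorem continuous_diagChar_conjRestrict [DiscreteTopology k] (ρ : ModPGaloisRep F k 2) (P : GL (Fin 2) k)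
    (hf : ∀ σ, (conjRestrict ρ P σ : Matrix (Fin 2) (Fin 2) k) 1 0 = 0) (i : Fin 2) :
    Continuous (diagChar (conjRestrict ρ P) hf i) := by
  have hρ : Continuous fun σ : absInertia F => ρ (σ : absoluteGaloisGroup F) :=
    ρ.continuous_toFun.comp continuous_subtype_val
  have h1 : Continuous fun σ : absInertia F => (diagChar (conjRestrict ρ P) hf i σ : k) :=
    (continuous_of_discreteTopology (f := fun A : GL (Fin 2) k =>
      ((P * A * P⁻¹ : GL (Fin 2) k) : Matrix (Fin 2) (Fin 2) k) i i)).comp hρ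
  refine Units.continuous_iff.mpr ⟨h1, ?_⟩
  convert h1.comp continuous_inv using 1
  funext σ
  change (((diagChar (conjRestrict ρ P) hf i σ)⁻¹ : kˣ) : k) =
    ((diagChar (conjRestrict ρ P) hf i σ⁻¹ : kˣ) : k)
  rw [map_inv]

/-- The diagonal characters have finite order prime to `p` (finite image, no `p`-torsion in
`kˣ`): there is `d > 0`, `p ∤ d`, with `χ_i(σ)^d = 1` for all `σ` and both `i`. [folklore] -/
theorem exists_diagChar_pow_eq_one [DiscreteTopology k]
    (hfin : ModPGaloisRep.finite_range (K := F) (k := k) (n := 2))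
    (ρ : ModPGaloisRep F k 2) (ι : absIntegers 𝒪[F] F ⧸ absMaximalIdeal F →+* k) (P : GL (Fin 2) k)
    (hf : ∀ σ, (conjRestrict ρ P σ : Matrix (Fin 2) (Fin 2) k) 1 0 = 0) :
    ∃ d : ℕ, 0 < d ∧ ¬ ringChar 𝓀[F] ∣ d ∧ ∀ (i : Fin 2) (σ : absInertia F),
      diagChar (conjRestrict ρ P) hf i σ ^ d = 1 := by
  haveI : Fact (ringChar 𝓀[F]).Prime := ⟨ringChar_residueField_prime⟩
  haveI : CharP k (ringChar 𝓀[F]) := charP_of_residueEmbedding ι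
  set R : Subgroup (GL (Fin 2) k) := ρ.toMonoidHom.range with hR
  haveI : Finite R := by
    have : (R : Set (GL (Fin 2) k)).Finite := by rw [hR, MonoidHom.coe_range]; exact hfin ρ
    exact this.to_subtype
  set N := Nat.card R with hN
  have hN0 : N ≠ 0 := Nat.card_pos.ne'
  have hρN : ∀ g : absoluteGaloisGroup F, ρ g ^ N = 1 := fun g => by
    have := pow_card_eq_one' (x := (⟨ρ.toMonoidHom g, ⟨g, rfl⟩⟩ : R))
    exact congrArg Subtype.val this
  have hχN : ∀ (i : Fin 2) (σ : absInertia F), diagChar (conjRestrict ρ P) hf i σ ^ N = 1 := by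
    intro i σ
    rw [← map_pow]
    ext
    rw [coe_diagChar_apply, map_pow, conjRestrict_apply, ← MulAut.conj_apply, ← map_pow, hρN,
      map_one]
    simp
  obtain ⟨d, hd, hpd, h0⟩ := exists_pow_eq_one_not_dvd (diagChar (conjRestrict ρ P) hf 0) hN0 (hχN 0)
  obtain ⟨s₀, d₀, hpd₀, hNeq⟩ :=
    Nat.exists_eq_pow_mul_and_not_dvd hN0 (ringChar 𝓀[F]) (Fact.out : (ringChar 𝓀[F]).Prime).ne_one
  refine ⟨d₀, Nat.pos_of_ne_zero (by rintro rfl; simp at hNeq; exact hN0 hNeq), hpd₀, fun i σ => ?_⟩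
  have := hχN i σ
  rw [hNeq, Units.ext_iff, Units.val_pow_eq_pow_val, Units.val_one] at this
  rw [Units.ext_iff, Units.val_pow_eq_pow_val, Units.val_one]
  exact pow_eq_one_of_pow_mul_eq_one this

/-- **Frobenius acts on the diagonal characters by `u ↦ u^q`.**  For an arithmetic Frobenius
`τ` (`IsFrobPow τ 1`) and `σ ∈ I_F`: `χ_i(τ σ τ⁻¹) = χ_i(σ)^q`, because `χ_i` is a power of a
Kummer character `θ_d` (`exists_eq_kummerCharacter_pow`) and `θ_d(τστ⁻¹) = θ_d(σ)^q`
(`kummerCharacter_conj_apply`).  Ref: Serre, Duke Math. J. 54 (1987), §2.1 ("l'ensemble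
`{φ, φ'}` est stable par l'opération de puissance `p`-ième"). [cite: Serre1987, §2.1] -/
theorem diagChar_conj_eq_pow [DiscreteTopology k]
    (hN4 : exists_eq_kummerCharacter_pow F k)
    (ρ : ModPGaloisRep F k 2) (ι : absIntegers 𝒪[F] F ⧸ absMaximalIdeal F →+* k) (P : GL (Fin 2) k)
    (hf : ∀ σ, (conjRestrict ρ P σ : Matrix (Fin 2) (Fin 2) k) 1 0 = 0) (i : Fin 2)
    {d : ℕ} (hd : 0 < d) (hpd : ¬ ringChar 𝓀[F] ∣ d) (hχd : ∀ σ, diagChar (conjRestrict ρ P) hf i σ ^ d = 1)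
    {τ : absoluteGaloisGroup F} (hτ : IsFrobPow τ 1) (σ : absInertia F)
    (h : τ * (σ : absoluteGaloisGroup F) * τ⁻¹ ∈ absInertia F) :
    (diagChar (conjRestrict ρ P) hf i ⟨τ * σ * τ⁻¹, h⟩ : k) =
      (diagChar (conjRestrict ρ P) hf i σ : k) ^ residueFieldCard F := by
  obtain ⟨ϖ, hϖ⟩ := IsDiscreteValuationRing.exists_irreducible 𝒪[F]
  obtain ⟨a, ha⟩ := hN4 ι hd hpd hϖ (diagChar (conjRestrict ρ P) hf i)
    (continuous_diagChar_conjRestrict ρ P hf i) hχd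
  have hτ' : IsFrobPow τ ((1 : ℕ) : ℤ) := hτ
  have key := kummerCharacter_conj_apply hd hϖ.ne_zero ι hτ' σ h
  rw [pow_one] at key
  rw [ha, MonoidHom.pow_apply, MonoidHom.pow_apply, Units.val_pow_eq_pow_val,
    Units.val_pow_eq_pow_val, key, ← pow_mul, ← pow_mul, mul_comm]

omit [TopologicalSpace k] in
/-- `{a, b} = {c, d}` from `a + b = c + d` and `a b = c d` (in a field). [folklore] -/
theorem eq_or_eq_of_add_eq_of_mul_eq {a b c d : k} (h1 : a + b = c + d) (h2 : a * b = c * d) :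
    (a = c ∧ b = d) ∨ (a = d ∧ b = c) := by
  have h : (a - c) * (a - d) = 0 := by linear_combination a * h1 - h2
  rcases mul_eq_zero.mp h with h | h
  · left; constructor
    · exact sub_eq_zero.mp h
    · have := sub_eq_zero.mp h; subst this; linear_combination h1
  · right; constructor
    · exact sub_eq_zero.mp h
    · have := sub_eq_zero.mp h; subst this; linear_combination h1

omit [TopologicalSpace k] in
/-- A group is not the union of two proper subgroups. [folklore] -/
theorem eq_top_or_eq_top_of_forall_mem_or {G : Type*} [Group G] {A B : Subgroup G}
    (h : ∀ g, g ∈ A ∨ g ∈ B) : A = ⊤ ∨ B = ⊤ := by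
  by_contra hcon
  push Not at hcon
  obtain ⟨hA, hB⟩ := hcon
  obtain ⟨a, ha⟩ : ∃ a, a ∉ A := by
    by_contra h'; push Not at h'; exact hA ((Subgroup.eq_top_iff' A).mpr h')
  obtain ⟨b, hb⟩ : ∃ b, b ∉ B := by
    by_contra h'; push Not at h'; exact hB ((Subgroup.eq_top_iff' B).mpr h')
  have haB : a ∈ B := (h a).resolve_left ha
  have hbA : b ∈ A := (h b).resolve_right hb
  rcases h (a * b) with hab | hab
  · exact ha (by simpa using A.mul_mem hab (A.inv_mem hbA))
  · exact hb (by simpa using B.mul_mem (B.inv_mem haB) hab)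

omit [TopologicalSpace k] in
/-- Powers of a character of exponent dividing `e`: `ψ σ ^ b = ψ σ ^ (b % e)`. [folklore] -/
theorem pow_eq_pow_mod {G : Type*} [Group G] {ψ : G →* kˣ} {e : ℕ} (hψ : ψ ^ e = 1) (σ : G) (b : ℕ) :
    ψ σ ^ b = ψ σ ^ (b % e) := by
  have h1 : ψ σ ^ e = 1 := by rw [← MonoidHom.pow_apply, hψ, MonoidHom.one_apply]
  conv_lhs => rw [← Nat.mod_add_div b e, pow_add, pow_mul, h1, one_pow, mul_one]

omit [TopologicalSpace k] in
/-- `ψ_m ^ (q ^ m - 1) = 1` for the fundamental character of level `m ≠ 0`.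
Ref: Serre, Invent. Math. 15 (1972), §1.7. [folklore] -/
theorem fundamentalCharacter_pow_eq_one {m : ℕ} (hm : m ≠ 0)
    (ι : absIntegers 𝒪[F] F ⧸ absMaximalIdeal F →+* k) (ϖ : 𝒪[F]) (hϖ : Irreducible ϖ) :
    fundamentalCharacter F m ι ϖ hϖ ^ (residueFieldCard F ^ m - 1) = 1 := by
  rw [fundamentalCharacter_of_ne_zero F hm]
  ext σ : 2
  rw [MonoidHom.pow_apply, Units.val_pow_eq_pow_val, coe_kummerCharacter_apply, ← map_pow,
    ← map_pow, kummerCocycleInt_pow, map_one, map_one, MonoidHom.one_apply, Units.val_one]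

omit [TopologicalSpace k] in
/-- **Serre's dichotomy (Prop. 1).**  If for every `g` the pair `{χ₀(g)^q, χ₁(g)^q}` equals
`{χ₀(g), χ₁(g)}`, then either (a) `χ₀^q = χ₀` and `χ₁^q = χ₁` (level one), or (b) `χ₀^q = χ₁`,
`χ₁^q = χ₀` and `χ₀ ≠ χ₁` (level two, conjugate characters).  (A group is not the union of
the two proper subgroups `{χ₀^q = χ₀}`, `{χ₀^q = χ₁}`.)
Ref: Serre, Duke Math. J. 54 (1987), §2.1, proof of Prop. 1 (cases (a), (b)).
[cite: Serre1987, §2.1 Prop. 1 (proof)] -/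
theorem level_dichotomy {G : Type*} [Group G] (χ₀ χ₁ : G →* kˣ) (q : ℕ)
    (hpair : ∀ g, (χ₀ g ^ q = χ₀ g ∧ χ₁ g ^ q = χ₁ g) ∨ (χ₀ g ^ q = χ₁ g ∧ χ₁ g ^ q = χ₀ g)) :
    (∀ g, χ₀ g ^ q = χ₀ g ∧ χ₁ g ^ q = χ₁ g) ∨
      ((∀ g, χ₀ g ^ q = χ₁ g ∧ χ₁ g ^ q = χ₀ g) ∧ ∃ g, χ₀ g ≠ χ₁ g) := by
  set A : Subgroup G := ((χ₀ ^ q) / χ₀).ker with hA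
  set B : Subgroup G := ((χ₀ ^ q) / χ₁).ker with hB
  set C : Subgroup G := ((χ₁ ^ q) / χ₀).ker with hC
  have hA' : ∀ g, g ∈ A ↔ χ₀ g ^ q = χ₀ g := fun g => by
    rw [hA, MonoidHom.mem_ker, MonoidHom.div_apply, MonoidHom.pow_apply, div_eq_one]
  have hB' : ∀ g, g ∈ B ↔ χ₀ g ^ q = χ₁ g := fun g => by
    rw [hB, MonoidHom.mem_ker, MonoidHom.div_apply, MonoidHom.pow_apply, div_eq_one]
  have hC' : ∀ g, g ∈ C ↔ χ₁ g ^ q = χ₀ g := fun g => by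
    rw [hC, MonoidHom.mem_ker, MonoidHom.div_apply, MonoidHom.pow_apply, div_eq_one]
  by_cases hAtop : A = ⊤
  · left
    intro g
    have h0 : χ₀ g ^ q = χ₀ g := (hA' g).mp (hAtop ▸ Subgroup.mem_top g)
    refine ⟨h0, ?_⟩
    rcases hpair g with h | h
    · exact h.2
    · have h10 : χ₁ g = χ₀ g := by rw [← h.1, h0]
      rw [h10, h0]
  · right
    have hAB : ∀ g, g ∈ A ∨ g ∈ B := fun g =>
      (hpair g).imp (fun h => (hA' g).mpr h.1) (fun h => (hB' g).mpr h.1)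
    have hBtop : B = ⊤ := (eq_top_or_eq_top_of_forall_mem_or hAB).resolve_left hAtop
    have hAC : ∀ g, g ∈ A ∨ g ∈ C := fun g =>
      (hpair g).imp (fun h => (hA' g).mpr h.1) (fun h => (hC' g).mpr h.2)
    have hCtop : C = ⊤ := (eq_top_or_eq_top_of_forall_mem_or hAC).resolve_left hAtop
    refine ⟨fun g => ⟨(hB' g).mp (hBtop ▸ Subgroup.mem_top g), (hC' g).mp (hCtop ▸ Subgroup.mem_top g)⟩,
      ?_⟩
    obtain ⟨g, hg⟩ : ∃ g, g ∉ A := by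
      by_contra h'; push Not at h'; exact hAtop ((Subgroup.eq_top_iff' A).mpr h')
    refine ⟨g, fun heq => hg ((hA' g).mpr ?_)⟩
    rw [(hB' g).mp (hBtop ▸ Subgroup.mem_top g), heq]

/-- `p ∤ q ^ m - 1` for `m ≠ 0` (`p ∣ q`). [folklore] -/
theorem not_ringChar_dvd_pow_sub_one {m : ℕ} (hm : m ≠ 0) :
    ¬ ringChar 𝓀[F] ∣ residueFieldCard F ^ m - 1 := by
  haveI : Fact (ringChar 𝓀[F]).Prime := ⟨ringChar_residueField_prime⟩
  intro h
  obtain ⟨f, hf0, hf'⟩ := residueFieldCard_eq_pow_ringChar F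
  have hp : ringChar 𝓀[F] ∣ residueFieldCard F ^ m := by
    rw [hf', ← pow_mul]
    exact dvd_pow_self _ (Nat.mul_ne_zero hf0.ne' hm)
  have h1 : 1 ≤ residueFieldCard F ^ m := Nat.one_le_pow _ _ (one_lt_residueFieldCard F).le
  have := (Nat.dvd_sub_iff_right h1 hp).mp h
  exact (Fact.out : (ringChar 𝓀[F]).Prime).ne_one (Nat.dvd_one.mp this)

omit [TopologicalSpace k] in
/-- From `x ^ q = x` to `x ^ (q - 1) = 1` in a group (`1 ≤ q`). [folklore] -/
theorem pow_sub_one_eq_one_of_pow_eq_self {x : kˣ} {q : ℕ} (hq : 1 ≤ q) (h : x ^ q = x) :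
    x ^ (q - 1) = 1 := by
  have hq' : q = (q - 1) + 1 := (Nat.sub_add_cancel hq).symm
  rw [hq', pow_succ] at h
  exact mul_eq_right.mp h

end DiagonalCharacters

/-! ### Assembly: Serre's Prop. 1 and the existence of a Serre weight -/

section Assembly

variable {F : Type u} [Field F] [ValuativeRel F] [TopologicalSpace F] [IsNonarchimedeanLocalField F]
variable {k : Type v} [Field k] [TopologicalSpace k]

omit [ValuativeRel F] [TopologicalSpace F] [IsNonarchimedeanLocalField F] in
/-- `ModPGaloisRep.finite_range` holds as soon as `Γ_F` is compact: a continuous map from a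
compact space to a discrete space has finite image.
Ref: Serre, Duke Math. J. 54 (1987), §1.1 ("`ρ` est continue, donc d'image finie"). [folklore] -/
theorem finite_range_of_compactSpace [CompactSpace (absoluteGaloisGroup F)] {n : ℕ} :
    ModPGaloisRep.finite_range (K := F) (k := k) (n := n) := by
  intro _ ρ
  exact (isCompact_range ρ.continuous_toFun).finite_of_discrete

omit [ValuativeRel F] [TopologicalSpace F] [IsNonarchimedeanLocalField F] in
/-- **Finite image** of a mod `p` representation of `Γ_F` (`k` discrete): `Γ_F` is compact
for every field `F` (`absoluteGaloisGroup_compactSpace`, file `AbsGaloisGroupCompact`).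
Ref: Serre, Duke Math. J. 54 (1987), §1.1 ("`ρ` est continue, donc d'image finie"). [folklore] -/
theorem finite_range_local {n : ℕ} : ModPGaloisRep.finite_range (K := F) (k := k) (n := n) :=
  @finite_range_of_compactSpace F _ k _ _ (absoluteGaloisGroup_compactSpace F) n

/-- **The wild case of Serre's recipe applies** when `ρ̄` is not tamely ramified: `ρ̄|I_F`
is `(χ^β *; 0 χ^α)` with `0 ≤ α ≤ q - 2`, `1 ≤ β ≤ q - 1`, so some `m` is a level-one wild
weight.  Ref: Serre, Duke Math. J. 54 (1987), §2.1, Prop. 1 (case (a)) and §2.4,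
(2.4.1)–(2.4.3). [cite: Serre1987, §2.1 Prop. 1 and §2.4 (2.4.1)–(2.4.3)] -/
theorem exists_isLevelOneWildWeight [DiscreteTopology k]
    (hfin : ModPGaloisRep.finite_range (K := F) (k := k) (n := 2))
    (hFrob : exists_isFrobPow (F := F))
    (hN1 : absUpperInertia_map_isPGroup F (GL (Fin 2) k))
    (hN4 : exists_eq_kummerCharacter_pow F k)
    (ρ : ModPGaloisRep F k 2) (ι : absIntegers 𝒪[F] F ⧸ absMaximalIdeal F →+* k)
    (hw : ¬ ρ.IsTamelyRamified) :
    ∃ m, ρ.IsLevelOneWildWeight ι m := by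
  classical
  haveI : Fact (ringChar 𝓀[F]).Prime := ⟨ringChar_residueField_prime⟩
  -- triangular form on all of `Γ_F`
  obtain ⟨v, hv, hev⟩ := exists_common_eigenvector_of_not_isTamelyRamified hfin hN1 ρ ι hw
  obtain ⟨P, hP⟩ := exists_conj_triangular ρ hv hev
  have hf : ∀ σ, (conjRestrict ρ P σ : Matrix (Fin 2) (Fin 2) k) 1 0 = 0 := fun σ => hP σ
  have hfΓ : ∀ g, (conjHom ρ P g : Matrix (Fin 2) (Fin 2) k) 1 0 = 0 := fun g => hP g
  -- Frobenius invariance of the `χ i` (they extend to `Γ_F`) and `χ i ^ q = χ i`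
  obtain ⟨τ, hτ⟩ := hFrob 1
  obtain ⟨d, hd, hpd, hχd⟩ := exists_diagChar_pow_eq_one hfin ρ ι P hf
  have hlevel : ∀ (i : Fin 2) (σ : absInertia F), diagChar (conjRestrict ρ P) hf i σ ^ residueFieldCard F = diagChar (conjRestrict ρ P) hf i σ := by
    intro i σ
    have hmem : τ * (σ : absoluteGaloisGroup F) * τ⁻¹ ∈ absInertia F := (absInertia_normal_holds F).conj_mem _ σ.2 τ
    have h1 := diagChar_conj_eq_pow hN4 ρ ι P hf i hd hpd (hχd i) hτ σ hmem
    -- `χ i` is the restriction of the character `diagChar (conjHom ρ P) hfΓ i` of `Γ_F`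
    have h2 : (diagChar (conjRestrict ρ P) hf i ⟨τ * σ * τ⁻¹, hmem⟩ : k) =
        (diagChar (conjRestrict ρ P) hf i σ : k) := by
      change (diagChar (conjHom ρ P) hfΓ i (τ * σ * τ⁻¹) : k) = (diagChar (conjHom ρ P) hfΓ i σ : k)
      rw [map_mul, map_mul, map_inv, mul_inv_cancel_comm]
    rw [h2] at h1
    exact Units.ext (by rw [Units.val_pow_eq_pow_val]; exact h1.symm)
  have hlevel' : ∀ (i : Fin 2) (σ : absInertia F),
      diagChar (conjRestrict ρ P) hf i σ ^ (residueFieldCard F ^ 1 - 1) = 1 := fun i σ => by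
    rw [pow_one]
    exact pow_sub_one_eq_one_of_pow_eq_self (one_lt_residueFieldCard F).le (hlevel i σ)
  -- `χ i = ψ₁ ^ b i`
  obtain ⟨ϖ, hϖ⟩ := IsDiscreteValuationRing.exists_irreducible 𝒪[F]
  have hq1 : ¬ ringChar 𝓀[F] ∣ residueFieldCard F ^ 1 - 1 := not_ringChar_dvd_pow_sub_one one_ne_zero
  obtain ⟨b₀, hb₀⟩ := hN4 ι (residueFieldCard_pow_sub_one_pos F one_ne_zero) hq1 hϖ (diagChar (conjRestrict ρ P) hf 0)
    (continuous_diagChar_conjRestrict ρ P hf 0) (hlevel' 0)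
  obtain ⟨b₁, hb₁⟩ := hN4 ι (residueFieldCard_pow_sub_one_pos F one_ne_zero) hq1 hϖ (diagChar (conjRestrict ρ P) hf 1)
    (continuous_diagChar_conjRestrict ρ P hf 1) (hlevel' 1)
  rw [← fundamentalCharacter_of_ne_zero F one_ne_zero ι ϖ hϖ] at hb₀ hb₁
  set ψ := fundamentalCharacter F 1 ι ϖ hϖ with hψ
  have hψq : ψ ^ (residueFieldCard F - 1) = 1 := fundamentalCharacter_one_pow_eq_one F ι ϖ hϖ
  -- normalised exponents
  set q := residueFieldCard F with hqdef
  have hq2 : 2 ≤ q := one_lt_residueFieldCard F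
  set α := b₁ % (q - 1) with hα
  set β := if b₀ % (q - 1) = 0 then q - 1 else b₀ % (q - 1) with hβ
  have hαlt : α < q - 1 := Nat.mod_lt _ (by omega)
  have hβ1 : 1 ≤ β := by
    rw [hβ]; split_ifs with h0
    · omega
    · exact Nat.pos_of_ne_zero h0
  have hβq : β + 1 ≤ q := by
    rw [hβ]; split_ifs with h0
    · omega
    · have := Nat.mod_lt b₀ (show 0 < q - 1 by omega); omega
  have hψα : ∀ σ, ψ σ ^ b₁ = ψ σ ^ α := fun σ => pow_eq_pow_mod hψq σ b₁
  have hψβ : ∀ σ, ψ σ ^ b₀ = ψ σ ^ β := by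
    intro σ
    rw [pow_eq_pow_mod hψq σ b₀, hβ]
    split_ifs with h0
    · rw [h0, pow_zero, ← MonoidHom.pow_apply, hψq, MonoidHom.one_apply]
    · rfl
  -- the shape
  have hshape : ρ.HasLevelOneInertiaShape ι ϖ hϖ β α := by
    refine ⟨P, fun σ => ⟨(conjRestrict ρ P σ : Matrix (Fin 2) (Fin 2) k) 0 1, ?_⟩⟩
    have := eq_of_diagChar (conjRestrict ρ P) hf σ
    rw [conjRestrict_apply] at this
    have h0 : (diagChar (conjRestrict ρ P) hf 0 σ : k) = (ψ σ ^ b₀ : kˣ) := by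
      rw [hb₀, MonoidHom.pow_apply]
    have h1 : (diagChar (conjRestrict ρ P) hf 1 σ : k) = (ψ σ ^ b₁ : kˣ) := by
      rw [hb₁, MonoidHom.pow_apply]
    rw [this, ← hψβ, ← hψα, ← h0, ← h1]
    rfl
  exact ⟨_, hw, α, β, by omega, hβ1, hβq, ⟨ϖ, hϖ, hshape⟩, rfl⟩

/-- **The tame cases of Serre's recipe apply** when `ρ̄` is tamely ramified: `ρ̄|I_F` is
diagonal with characters `φ, φ'` which are either both of level one (`ρ̄|I_F ≃ χ^a ⊕ χ^b`,
`0 ≤ a ≤ b ≤ q - 2`: a level-one tame weight exists) or of level two and conjugate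
(`ρ̄|I_F ≃ ψ^{a+qb} ⊕ ψ^{qa+b}`, `0 ≤ a < b ≤ q - 1`: a level-two weight exists).
Ref: Serre, Duke Math. J. 54 (1987), §2.1, Prop. 1; §2.2, (2.2.1)–(2.2.3); §2.3, (2.3.1).
[cite: Serre1987, §2.1 Prop. 1, §2.2 (2.2.1)–(2.2.3), §2.3 (2.3.1)] -/
theorem exists_isLevelTwoWeight_or_isLevelOneTameWeight [DiscreteTopology k]
    (hfin : ModPGaloisRep.finite_range (K := F) (k := k) (n := 2))
    (hFrob : exists_isFrobPow (F := F))
    (hN3 : absInertia_map_isCyclic F (GL (Fin 2) k)) (hN4 : exists_eq_kummerCharacter_pow F k)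
    (ρ : ModPGaloisRep F k 2) (ι : absIntegers 𝒪[F] F ⧸ absMaximalIdeal F →+* k)
    (ht : ρ.IsTamelyRamified) :
    ∃ m, ρ.IsLevelTwoWeight ι m ∨ ρ.IsLevelOneTameWeight ι m := by
  classical
  haveI : Fact (ringChar 𝓀[F]).Prime := ⟨ringChar_residueField_prime⟩
  -- diagonal form on `I_F`
  obtain ⟨P, hP⟩ := exists_conj_diagonal_of_isTamelyRamified hN3 ρ ι ht
  have hf : ∀ σ, (conjRestrict ρ P σ : Matrix (Fin 2) (Fin 2) k) 1 0 = 0 := fun σ => (hP σ).1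
  have hf01 : ∀ σ, (conjRestrict ρ P σ : Matrix (Fin 2) (Fin 2) k) 0 1 = 0 := fun σ => (hP σ).2
  have hdiag : ∀ σ, (conjRestrict ρ P σ : Matrix (Fin 2) (Fin 2) k) =
      !![(diagChar (conjRestrict ρ P) hf 0 σ : k), 0; 0, (diagChar (conjRestrict ρ P) hf 1 σ : k)] := by
    intro σ
    rw [eq_of_diagChar (conjRestrict ρ P) hf σ, hf01 σ]
  -- Frobenius: `{χ₀(σ)^q, χ₁(σ)^q} = {χ₀(σ), χ₁(σ)}`
  obtain ⟨τ, hτ⟩ := hFrob 1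
  obtain ⟨d, hd, hpd, hχd⟩ := exists_diagChar_pow_eq_one hfin ρ ι P hf
  set q := residueFieldCard F with hqdef
  have hpair : ∀ σ : absInertia F,
      (diagChar (conjRestrict ρ P) hf 0 σ ^ q = diagChar (conjRestrict ρ P) hf 0 σ ∧
        diagChar (conjRestrict ρ P) hf 1 σ ^ q = diagChar (conjRestrict ρ P) hf 1 σ) ∨
      (diagChar (conjRestrict ρ P) hf 0 σ ^ q = diagChar (conjRestrict ρ P) hf 1 σ ∧
        diagChar (conjRestrict ρ P) hf 1 σ ^ q = diagChar (conjRestrict ρ P) hf 0 σ) := by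
    intro σ
    have hmem : τ * (σ : absoluteGaloisGroup F) * τ⁻¹ ∈ absInertia F := (absInertia_normal_holds F).conj_mem _ σ.2 τ
    have e0 := diagChar_conj_eq_pow hN4 ρ ι P hf 0 hd hpd (hχd 0) hτ σ hmem
    have e1 := diagChar_conj_eq_pow hN4 ρ ι P hf 1 hd hpd (hχd 1) hτ σ hmem
    -- `f(τστ⁻¹)` is conjugate to `f(σ)`
    set T : GL (Fin 2) k := P * ρ τ * P⁻¹ with hT
    have hconj : conjRestrict ρ P ⟨τ * σ * τ⁻¹, hmem⟩ = T * conjRestrict ρ P σ * T⁻¹ := by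
      rw [conjRestrict_apply, conjRestrict_apply, hT]
      change P * ρ (τ * σ * τ⁻¹) * P⁻¹ = _
      rw [map_mul, map_mul, map_inv]
      group
    have htr : ((conjRestrict ρ P ⟨τ * σ * τ⁻¹, hmem⟩ : GL (Fin 2) k) : Matrix (Fin 2) (Fin 2) k).trace =
        ((conjRestrict ρ P σ : GL (Fin 2) k) : Matrix (Fin 2) (Fin 2) k).trace := by
      rw [hconj, Matrix.GeneralLinearGroup.coe_mul, Matrix.GeneralLinearGroup.coe_mul,
        Matrix.trace_units_conj]
    have hdet : ((conjRestrict ρ P ⟨τ * σ * τ⁻¹, hmem⟩ : GL (Fin 2) k) : Matrix (Fin 2) (Fin 2) k).det =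
        ((conjRestrict ρ P σ : GL (Fin 2) k) : Matrix (Fin 2) (Fin 2) k).det := by
      rw [hconj, Matrix.GeneralLinearGroup.coe_mul, Matrix.GeneralLinearGroup.coe_mul,
        Matrix.det_units_conj]
    rw [hdiag, hdiag, Matrix.trace_fin_two_of, Matrix.trace_fin_two_of, e0, e1] at htr
    rw [hdiag, hdiag, Matrix.det_fin_two_of, Matrix.det_fin_two_of, e0, e1] at hdet
    simp only [mul_zero, sub_zero] at hdet
    rcases eq_or_eq_of_add_eq_of_mul_eq htr hdet with h | h
    · left
      exact ⟨Units.ext (by rw [Units.val_pow_eq_pow_val]; exact h.1),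
        Units.ext (by rw [Units.val_pow_eq_pow_val]; exact h.2)⟩
    · right
      exact ⟨Units.ext (by rw [Units.val_pow_eq_pow_val]; exact h.1),
        Units.ext (by rw [Units.val_pow_eq_pow_val]; exact h.2)⟩
  obtain ⟨ϖ, hϖ⟩ := IsDiscreteValuationRing.exists_irreducible 𝒪[F]
  have hq2 : 2 ≤ q := one_lt_residueFieldCard F
  rcases level_dichotomy _ _ q hpair with hone | ⟨htwo, σ₁, hσ₁⟩
  · ---------------------------------------------------------------- level one, tame
    have hlevel' : ∀ (i : Fin 2) (σ : absInertia F),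
        diagChar (conjRestrict ρ P) hf i σ ^ (residueFieldCard F ^ 1 - 1) = 1 := fun i σ => by
      rw [pow_one]
      refine pow_sub_one_eq_one_of_pow_eq_self (one_lt_residueFieldCard F).le ?_
      fin_cases i
      · exact (hone σ).1
      · exact (hone σ).2
    have hq1 : ¬ ringChar 𝓀[F] ∣ residueFieldCard F ^ 1 - 1 := not_ringChar_dvd_pow_sub_one one_ne_zero
    obtain ⟨b₀, hb₀⟩ := hN4 ι (residueFieldCard_pow_sub_one_pos F one_ne_zero) hq1 hϖ
      (diagChar (conjRestrict ρ P) hf 0) (continuous_diagChar_conjRestrict ρ P hf 0) (hlevel' 0)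
    obtain ⟨b₁, hb₁⟩ := hN4 ι (residueFieldCard_pow_sub_one_pos F one_ne_zero) hq1 hϖ
      (diagChar (conjRestrict ρ P) hf 1) (continuous_diagChar_conjRestrict ρ P hf 1) (hlevel' 1)
    rw [← fundamentalCharacter_of_ne_zero F one_ne_zero ι ϖ hϖ] at hb₀ hb₁
    set ψ := fundamentalCharacter F 1 ι ϖ hϖ with hψ
    have hψq : ψ ^ (q - 1) = 1 := fundamentalCharacter_one_pow_eq_one F ι ϖ hϖ
    set a := b₀ % (q - 1) with ha
    set b := b₁ % (q - 1) with hb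
    have halt : a < q - 1 := Nat.mod_lt _ (by omega)
    have hblt : b < q - 1 := Nat.mod_lt _ (by omega)
    have hdiag' : ∀ σ, (conjRestrict ρ P σ : Matrix (Fin 2) (Fin 2) k) =
        !![((ψ σ ^ a : kˣ) : k), 0; 0, ((ψ σ ^ b : kˣ) : k)] := by
      intro σ
      rw [hdiag σ, hb₀, hb₁, MonoidHom.pow_apply, MonoidHom.pow_apply, pow_eq_pow_mod hψq σ b₀,
        pow_eq_pow_mod hψq σ b₁]
    by_cases hab : a ≤ b
    · have hshape : ρ.HasLevelOneInertiaShape ι ϖ hϖ a b := by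
        refine ⟨P, fun σ => ⟨0, ?_⟩⟩
        rw [← conjRestrict_apply, hdiag' σ]
      exact ⟨_, Or.inr ⟨ht, a, b, hab, by omega, ⟨ϖ, hϖ, hshape⟩, rfl⟩⟩
    · have hshape : ρ.HasLevelOneInertiaShape ι ϖ hϖ b a := by
        refine ⟨swapGL * P, fun σ => ⟨0, ?_⟩⟩
        rw [mul_inv_rev, show swapGL * P * ρ (σ : absoluteGaloisGroup F) * (P⁻¹ * swapGL⁻¹) =
          swapGL * (P * ρ (σ : absoluteGaloisGroup F) * P⁻¹) * swapGL⁻¹ by group,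
          Matrix.GeneralLinearGroup.coe_mul, Matrix.GeneralLinearGroup.coe_mul, ← conjRestrict_apply,
          hdiag' σ, swapGL_conj_diag]
      exact ⟨_, Or.inr ⟨ht, b, a, by omega, by omega, ⟨ϖ, hϖ, hshape⟩, rfl⟩⟩
  · ---------------------------------------------------------------- level two
    have hq21 : ¬ ringChar 𝓀[F] ∣ residueFieldCard F ^ 2 - 1 := not_ringChar_dvd_pow_sub_one two_ne_zero
    have hlevel2 : ∀ σ : absInertia F,
        diagChar (conjRestrict ρ P) hf 0 σ ^ (residueFieldCard F ^ 2 - 1) = 1 := fun σ => by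
      refine pow_sub_one_eq_one_of_pow_eq_self (Nat.one_le_pow _ _ (by omega)) ?_
      rw [pow_two, pow_mul, (htwo σ).1, (htwo σ).2]
    obtain ⟨n, hn⟩ := hN4 ι (residueFieldCard_pow_sub_one_pos F two_ne_zero) hq21 hϖ
      (diagChar (conjRestrict ρ P) hf 0) (continuous_diagChar_conjRestrict ρ P hf 0) hlevel2
    rw [← fundamentalCharacter_of_ne_zero F two_ne_zero ι ϖ hϖ] at hn
    set ψ := fundamentalCharacter F 2 ι ϖ hϖ with hψ
    have hψq : ψ ^ (q ^ 2 - 1) = 1 := fundamentalCharacter_pow_eq_one two_ne_zero ι ϖ hϖ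
    have hψq' : ∀ σ, ψ σ ^ (q ^ 2) = ψ σ := fun σ => by
      have h1 : ψ σ ^ (q ^ 2 - 1) = 1 := by rw [← MonoidHom.pow_apply, hψq, MonoidHom.one_apply]
      have : q ^ 2 = (q ^ 2 - 1) + 1 := (Nat.sub_add_cancel (Nat.one_le_pow _ _ (by omega))).symm
      rw [this, pow_succ, h1, one_mul]
    set n' := n % (q ^ 2 - 1) with hn'
    set a := n' % q with ha
    set b := n' / q with hb
    have hn'lt : n' < q ^ 2 - 1 := Nat.mod_lt _ (residueFieldCard_pow_sub_one_pos F two_ne_zero)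
    have halt : a < q := Nat.mod_lt _ (by omega)
    have hblt : b < q := by
      rw [hb, Nat.div_lt_iff_lt_mul (by omega)]
      have : q ^ 2 = q * q := pow_two q
      omega
    have hab' : a + q * b = n' := Nat.mod_add_div n' q
    have e0 : ∀ σ, diagChar (conjRestrict ρ P) hf 0 σ = ψ σ ^ (a + q * b) := fun σ => by
      rw [hn, MonoidHom.pow_apply, pow_eq_pow_mod hψq σ n, ← hn', hab']
    have e1 : ∀ σ, diagChar (conjRestrict ρ P) hf 1 σ = ψ σ ^ (q * a + b) := fun σ => by
      rw [← (htwo σ).1, e0 σ, ← pow_mul,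
        show (a + q * b) * q = q * a + q ^ 2 * b by ring, pow_add, pow_mul, pow_mul, hψq', pow_add,
        pow_mul]
    have hab : a ≠ b := by
      intro heq
      apply hσ₁
      rw [e0, e1, heq, add_comm]
    by_cases hlt : a < b
    · have hshape : ρ.HasLevelTwoInertiaShape ι ϖ hϖ a b := by
        refine ⟨P, fun σ => ?_⟩
        rw [← conjRestrict_apply, hdiag σ, e0, e1]
      exact ⟨_, Or.inl ⟨a, b, hlt, by omega, ⟨ϖ, hϖ, hshape⟩, rfl⟩⟩
    · have hba : b < a := lt_of_le_of_ne (not_lt.mp hlt) (Ne.symm hab)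
      have hshape : ρ.HasLevelTwoInertiaShape ι ϖ hϖ b a := by
        refine ⟨swapGL * P, fun σ => ?_⟩
        rw [mul_inv_rev, show swapGL * P * ρ (σ : absoluteGaloisGroup F) * (P⁻¹ * swapGL⁻¹) =
          swapGL * (P * ρ (σ : absoluteGaloisGroup F) * P⁻¹) * swapGL⁻¹ by group,
          Matrix.GeneralLinearGroup.coe_mul, Matrix.GeneralLinearGroup.coe_mul, ← conjRestrict_apply,
          hdiag σ, e0, e1, swapGL_conj_diag, add_comm (q * a) b, add_comm a (q * b)]
      exact ⟨_, Or.inl ⟨b, a, hba, by omega, ⟨ϖ, hϖ, hshape⟩, rfl⟩⟩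

/-- **Serre's Prop. 1 with the normalisations of §§2.2–2.4: some case of the recipe applies.**
`exists_isSerreWeight` (existence of a Serre weight for `k` discrete) follows from the named
structure facts on the inertia of `F` (`TameInertia`: `p`-group image of `I_F^v`, normality of
`I_F^v`, cyclic prime-to-`p` tame quotients, characters of `I_F` as powers of `θ_d`) together
with theorems: the existence of a Frobenius (`exists_isFrobPow_holds`), the finiteness of the
image of `ρ̄` (`finite_range_local`) and the normality of `I_F` (`absInertia_normal_holds`) and of
`I_F^v` (`absUpperInertia_normal`).
Ref: Serre, Duke Math. J. 54 (1987), §2.1, Prop. 1; §§2.2–2.4.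
[cite: Serre1987, §2.1 Prop. 1; §2.2–2.4] -/
theorem exists_isSerreWeight_of_facts
    (hN1 : absUpperInertia_map_isPGroup F (GL (Fin 2) k))
    (hN3 : absInertia_map_isCyclic F (GL (Fin 2) k)) (hN4 : exists_eq_kummerCharacter_pow F k)
    (ρ : ModPGaloisRep F k 2) (ι : absIntegers 𝒪[F] F ⧸ absMaximalIdeal F →+* k) :
    ρ.exists_isSerreWeight ι := by
  intro _
  have hfin : ModPGaloisRep.finite_range (K := F) (k := k) (n := 2) := finite_range_local
  have hFrob : exists_isFrobPow (F := F) := exists_isFrobPow_holds F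
  by_cases ht : ρ.IsTamelyRamified
  · obtain ⟨m, hm | hm⟩ :=
      exists_isLevelTwoWeight_or_isLevelOneTameWeight hfin hFrob hN3 hN4 ρ ι ht
    · exact ⟨m, hm.isSerreWeight⟩
    · exact ⟨m, hm.isSerreWeight⟩
  · obtain ⟨m, hm⟩ := exists_isLevelOneWildWeight hfin hFrob hN1 hN4 ρ ι ht
    exact ⟨m, hm.isSerreWeight⟩

/-- **The lower bound `2 ≤ k(ρ̄_F)` from the structure facts.**  `two_le_serreWeightLocal`
follows from `exists_isSerreWeight_of_facts` by `two_le_serreWeightLocal_of_exists`.  What separates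
this from an unconditional `two_le_serreWeightLocal_holds` is exactly the discharge of the
three named facts in the hypotheses (Serre, *Local Fields*, Ch. IV §2–3 with Herbrand's
theorem; Serre, Invent. Math. 15 (1972), §1.3, §1.7 Prop. 5).
Ref: Serre, Duke Math. J. 54 (1987), §2.1 Prop. 1 and §2.6 (Valeurs de `k`).
[cite: Serre1987, §2.1 Prop. 1 and §2.6] -/
theorem two_le_serreWeightLocal_of_facts
    (hN1 : absUpperInertia_map_isPGroup F (GL (Fin 2) k))
    (hN3 : absInertia_map_isCyclic F (GL (Fin 2) k)) (hN4 : exists_eq_kummerCharacter_pow F k)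
    (ρ : ModPGaloisRep F k 2) (ι : absIntegers 𝒪[F] F ⧸ absMaximalIdeal F →+* k) :
    ρ.two_le_serreWeightLocal ι :=
  two_le_serreWeightLocal_of_exists ρ ι (exists_isSerreWeight_of_facts hN1 hN3 hN4 ρ ι)

end Assembly

end InertiaShape


end ModPGaloisRep

end Literature.NumberTheory.GaloisRepresentations
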